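import Literature.Analysis.FluidPDE.AxisymNoSwirlCoSignedFlux
import HarnessLib

/-!
# Axisymmetric flows without swirl: the `L^p` balance of `η = ω_θ/r` WITH its dissipation
# (Feng–Šverák 2015, proof of Lemma 3.8; Gallay–Šverák 2015, Lemma 5.2)

Analysis/FluidPDE proof file (theorems only; no definitions, no named facts).

For the axisymmetric Navier–Stokes equations without swirl the quantity `η = ω_θ/r` solves
(Gallay–Šverák 2015, (2.9); Feng–Šverák 2015, (1.16))

  `∂ₜη + u·∇η = ν(Δη + (2/r)∂ᵣη)`,   `div (u − 2ν e_r/r) = −4πν δ_{r=0} ≤ 0`,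

and the "classical method due to Nash" (Gallay–Šverák, before Lemma 5.2) starts from the `L^p`
energy identity in which the dissipation is KEPT. Feng–Šverák print it (arXiv:1301.6317, proof of
Lemma 3.8, p. 12, display (3.23)–(3.24), `ν = 1`, `p = 2ⁿ`):

> `−dE_p/dt = −d/dt ∫ η^p dx = −∫ p η^{p−1} (Δη + (2/r)η_{,r} − u·∇η) dx`
> `= ∫ p(p−1) η^{p−2} |∇η|² dx + 4π ∫ [η^p]_{r=0} dz ≥ (4(p−1)/p) ∫ |∇(η^{p/2})|² dx.`

The tree's `AxisymNoSwirlCoSignedFlux` proves the sign `d/dt ∫ β(η) ≤ 0` for convex `β` along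
Tao-class swirl-free flows, DISCARDING the dissipation (its private
`integral_deriv_comp_mul_fderiv_fderiv_nonpos` turns `∫ β'(η)∂ᵢ∂ᵢη = −∫ β''(η)(∂ᵢη)²` into `≤ 0`).
This file re-runs that computation keeping the dissipation, which is the one input of the Nash
iteration (Feng–Šverák Lemma 3.8 = Gallay–Šverák Lemma 5.2) not yet in the tree:

* `integral_deriv_comp_mul_add_dissipation_le_of_drift_laplacian` — **fixed time, convex
  functional.** For `β ∈ C²` with `β(0) = β'(0) = 0`, `β'' ≥ 0`, `|β''| ≤ K` on `[−F, F]`; an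
  axisymmetric scalar `G ∈ C²` on `ℝ³` with `|G| ≤ F`, `G, ∂ᵢG, ∂ᵢ∂ᵢG, radDerivQuot G ∈ L²`; a
  divergence-free drift `b ∈ C¹` bounded with bounded derivative; `ν ≥ 0`; and pointwise
  `G' + DG[b] = ν(ΔG + 2 radDerivQuot G) + R` with `β'(G)R` integrable:
  `∫ β'(G) G' + ν ∫ β''(G) ‖DG‖² ≤ ∫ β'(G) R`
  (transport term `0`, diffusion `= −ν∫β''(G)‖DG‖²` exactly, axis term `≤ 0` by the tree's
  `IsAxisymmetricScalar.integral_deriv_comp_mul_radDerivQuot_nonpos` — Feng–Šverák's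
  `4π∫[η^p]_{r=0} dz ≥ 0`).
* `IsTaoSolutionOn.exists_forall_abs_angVortQuot_le` — `η = angVortQuot` is bounded on the slab of a
  Tao-class solution (`|η| ≤ ‖D curl u‖ ≤ ‖curlCLM‖ ‖D²u‖`).
* `IsTaoSolutionOn.integral_deriv_comp_mul_angVortQuot_add_dissipation_nonpos` — **the slice
  inequality in Tao's class**: for a Tao-class solution on `[0, T]`, `ν ≥ 0`, with axisymmetric
  swirl-free slices and `β ∈ C²` convex with `β(0) = β'(0) = 0`:
  `∫ β'(η(t)) η'(t) dx + ν ∫ β''(η(t)) ‖∇η(t)‖² dx ≤ 0` (`η' = angVortQuot (∂ₜu)`).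
* `IsTaoSolutionOn.integral_comp_angVortQuot_add_dissipation_le` — **the balance**: for
  `0 ≤ s ≤ t ≤ T`,
  `∫ β(η(t)) dx + ν ∫ₛᵗ ∫ β''(η(τ)) ‖∇η(τ)‖² dx dτ ≤ ∫ β(η(s)) dx`
  (the time function `τ ↦ ∫ β''(η)‖∇η‖²` is integrable on `(0, T)`: jointly continuous integrand,
  `β''(η) ≤ K`, `∫‖∇η(τ)‖² ≤ C` uniformly), and the version from an axisymmetric swirl-free DATUM
  (`ν > 0`), `…_of_datum`.
* `IsTaoSolutionOn.integral_pow_angVortQuot_add_dissipation_le` — **the `L^p` balance,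
  `p = 2k`:** `∫ η(t)^{2k} + ν (2k)(2k−1) ∫ₛᵗ∫ η^{2k−2}‖∇η‖² ≤ ∫ η(s)^{2k}` (`β(v) = v^{2k}`), its
  `L²` case `…integral_sq_angVortQuot_add_dissipation_le`
  (`∫ η(t)² + 2ν∫ₛᵗ∫‖∇η‖² ≤ ∫ η(s)²`), and Feng–Šverák's form
  `…integral_pow_angVortQuot_add_norm_fderiv_pow_le`:
  `∫ η(t)^{2k} + ν (2(2k−1)/k) ∫ₛᵗ∫ ‖∇(η^k)‖² ≤ ∫ η(s)^{2k}` (`‖∇(η^k)‖² = k² η^{2k−2}‖∇η‖²`,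
  `(2k)(2k−1)/k² = 4(p−1)/p`).

What is NOT here: the Nash inequality itself (tree: `pow_five_integral_sq_le_nash`,
`NashInequalityWholeSpace`), the ODE/iteration step (tree: `le_mul_rpow_of_le_sub_intervalIntegral`,
`SingularBernoulliComparison`) and their assembly into Lemma 3.8 / Lemma 5.2; the `L¹`
monotonicity (tree: `IsTaoSolutionOn.lintegral_abs_angVortQuot_le`).

Dictionary: `angVortQuot u = ω_θ/r = η` (`IsAxisymmetric.cylRadius_sq_mul_angVortQuot`), and for
a scalar `G` on `ℝ³`, `‖DG(x)‖² = Σᵢ (∂ᵢG(x))²` (`‖fderiv ℝ G x‖`, the operator norm of the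
differential, is the Euclidean length of the gradient).

## Mathlib / tree search

Tree (all used): `AxisymNoSwirlCoSignedFlux` (`IsAxisymmetricScalar.integral_deriv_comp_mul_radDerivQuot_nonpos`,
`integral_comp_le_add_intervalIntegral_of_ae_hasDerivAt`, the pattern of
`integral_deriv_comp_mul_le_of_drift_laplacian` and of `IsTaoSolutionOn.antitoneOn_integral_comp_angVortQuot`),
`IsClassicalNSSolutionOn.angVortQuot_eq` (`AxisymQuotientEquationsOmega`),
`integral_mul_fderiv_apply_eq_neg_of_isDivFree'` (`AxisymTransportIBP`),
`integral_mul_fderiv_eq_neg_of_differentiable` (`HouLeiLiEstimate`),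
`IsTaoSolutionOn.memLp_angVortQuot_data`, `…exists_lintegral_sq_quot_le`,
`exists_lintegral_sq_iteratedFDeriv_angVortQuot_le`, `HasBoundedSobolevNormsOn.exists_forall_norm_iteratedFDeriv_le`,
`norm_fderiv_curl_le`, `IsAxisymmetric.abs_angVortQuot_le_norm_fderiv_curl`,
`IsSmoothSpaceTimeOn.angVortQuot_family`, `…fderiv_slice_apply`, `…timeDerivWithin_angVortQuot`,
`aestronglyMeasurable_prod_of_continuousOn_off_axis`. `lean search 'LpDissipation|integral_pow_angVortQuot|
angVortQuot.*dissipation'` (2026-08-27): nothing — the tree's `∫ β(η)`, `∫ η²`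
(`ladyzhenskaya_weighted_estimate`, `IsTaoSolutionOn.integral_hadamardQuotFst_sq_le`) and `∫|η|`
statements all drop the dissipation. Mathlib: `Convex.norm_image_sub_le_of_norm_deriv_le`,
`IsCompact.exists_bound_of_continuousOn`, `InnerProductSpace.toDual`,
`intervalIntegral.integral_mono_on`, `MeasureTheory.Integrable.integral_prod_left`.

## References

* H. Feng, V. Šverák, *On the Cauchy problem for axi-symmetric vortex rings*, Arch. Ration. Mech.
  Anal. 215 (2015) 89–123 = arXiv:1301.6317, proof of Lemma 3.8 (arXiv p. 12: the display for
  `−dE_p/dt`, "the drift term `(2/r)η_{,r}` has a good sign"). [FengSverak2015]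
* Th. Gallay, V. Šverák, *Remarks on the Cauchy problem for the axisymmetric Navier–Stokes
  equations*, Confluentes Math. 7 (2015) 67–92 = arXiv:1510.01036, (2.9) and §5 Lemma 5.2 with the
  sentence before it (`div(u − 2e_r/r) = −4πδ_{r=0} ≤ 0`, arXiv p. 16). [GallaySverak2016]
-/

noncomputable section

open MeasureTheory Set Function Filter Topology InnerProductSpace WithLp
open scoped RealInnerProductSpace Laplacian ContDiff ENNReal NNReal Topology

namespace Literature.Analysis.FluidPDE

namespace AxisymNoSwirlLpDissipation

/-! ### Convex `C²` functions: local bounds from `|β''| ≤ K` on `[−F, F]` -/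

section Convex

variable {β : ℝ → ℝ} {K F : ℝ}

/-- For `β ∈ C²`: `β` and `β'` are differentiable. [folklore] -/
private theorem differentiable_of_contDiff_two (hβ : ContDiff ℝ 2 β) :
    Differentiable ℝ β ∧ Differentiable ℝ (deriv β) := by
  refine ⟨hβ.differentiable (by norm_num), ?_⟩
  have h1 : ContDiff ℝ 1 (deriv β) := ContDiff.deriv' (n := 1) (by exact_mod_cast hβ)
  exact h1.differentiable one_ne_zero

/-- For `β ∈ C²`, `β''` is continuous. [folklore] -/
private theorem continuous_deriv_deriv_of_contDiff_two (hβ : ContDiff ℝ 2 β) :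
    Continuous (deriv (deriv β)) := by
  have h1 : ContDiff ℝ 1 (deriv β) := ContDiff.deriv' (n := 1) (by exact_mod_cast hβ)
  exact h1.continuous_deriv le_rfl

/-- For `β ∈ C²` and `F`, `|β''| ≤ K` on `[−F, F]` for some `K ≥ 0` (continuity on a compact
interval). [folklore] -/
private theorem exists_abs_deriv_deriv_le (hβ : ContDiff ℝ 2 β) (F : ℝ) :
    ∃ K : ℝ, 0 ≤ K ∧ ∀ v, |v| ≤ F → |deriv (deriv β) v| ≤ K := by
  obtain ⟨K, hK⟩ := isCompact_Icc.exists_bound_of_continuousOn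
    ((continuous_deriv_deriv_of_contDiff_two hβ).continuousOn (s := Icc (-F) F))
  refine ⟨max K 0, le_max_right _ _, fun v hv => ?_⟩
  have hvI : v ∈ Icc (-F) F := ⟨(abs_le.1 hv).1, (abs_le.1 hv).2⟩
  have := hK v hvI
  rw [Real.norm_eq_abs] at this
  exact this.trans (le_max_left _ _)

/-- The segment `[0, v]` lies in `[−F, F]` when `|v| ≤ F`. [folklore] -/
private theorem abs_le_of_mem_uIcc {v : ℝ} (hv : |v| ≤ F) {x : ℝ} (hx : x ∈ uIcc 0 v) : |x| ≤ F := by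
  rcases le_total 0 v with h | h
  · rw [uIcc_of_le h] at hx
    rw [abs_of_nonneg hx.1]
    exact hx.2.trans ((le_abs_self v).trans hv)
  · rw [uIcc_of_ge h] at hx
    rw [abs_of_nonpos hx.2]
    have : -v ≤ F := (neg_le_abs v).trans hv
    linarith [hx.1]

/-- If `β'(0) = 0` and `|β''| ≤ K` on `[−F, F]` then `|β'(v)| ≤ K |v|` for `|v| ≤ F` (mean value
inequality on the segment `[0, v]`). [folklore] -/
private theorem abs_deriv_le_mul_abs (hβ : ContDiff ℝ 2 β) (h0 : deriv β 0 = 0)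
    (hK : ∀ v, |v| ≤ F → |deriv (deriv β) v| ≤ K) {v : ℝ} (hv : |v| ≤ F) :
    |deriv β v| ≤ K * |v| := by
  obtain ⟨-, hd'⟩ := differentiable_of_contDiff_two hβ
  have h := Convex.norm_image_sub_le_of_norm_deriv_le (f := deriv β) (s := uIcc 0 v) (x := 0)
    (y := v) (fun x _ => hd' x)
    (fun x hx => by rw [Real.norm_eq_abs]; exact hK x (abs_le_of_mem_uIcc hv hx))
    (convex_uIcc 0 v) left_mem_uIcc right_mem_uIcc
  rw [h0, sub_zero, sub_zero, Real.norm_eq_abs, Real.norm_eq_abs] at h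
  exact h

/-- If `β(0) = β'(0) = 0` and `|β''| ≤ K` on `[−F, F]` then `|β(v)| ≤ K v²` for `|v| ≤ F`.
[folklore] -/
private theorem abs_le_mul_sq (hβ : ContDiff ℝ 2 β) (h00 : β 0 = 0) (h0 : deriv β 0 = 0)
    (hK : ∀ v, |v| ≤ F → |deriv (deriv β) v| ≤ K) {v : ℝ} (hv : |v| ≤ F) :
    |β v| ≤ K * v ^ 2 := by
  obtain ⟨hd, -⟩ := differentiable_of_contDiff_two hβ
  have hK0 : 0 ≤ K := (abs_nonneg _).trans (hK 0 (by rw [abs_zero]; exact (abs_nonneg v).trans hv))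
  have hseg : ∀ x ∈ uIcc 0 v, ‖deriv β x‖ ≤ K * |v| := by
    intro x hx
    rw [Real.norm_eq_abs]
    have hxF : |x| ≤ F := abs_le_of_mem_uIcc hv hx
    refine (abs_deriv_le_mul_abs hβ h0 hK hxF).trans (mul_le_mul_of_nonneg_left ?_ hK0)
    rcases le_total 0 v with h | h
    · rw [uIcc_of_le h] at hx
      rw [abs_of_nonneg hx.1, abs_of_nonneg h]; exact hx.2
    · rw [uIcc_of_ge h] at hx
      rw [abs_of_nonpos hx.2, abs_of_nonpos h]; linarith [hx.1]
  have h := Convex.norm_image_sub_le_of_norm_deriv_le (f := β) (s := uIcc 0 v) (x := 0) (y := v)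
    (fun x _ => hd x) hseg (convex_uIcc 0 v) left_mem_uIcc right_mem_uIcc
  rw [h00, sub_zero, sub_zero, Real.norm_eq_abs, Real.norm_eq_abs] at h
  calc |β v| ≤ K * |v| * |v| := h
    _ = K * v ^ 2 := by rw [mul_assoc, abs_mul_abs_self, sq]

/-- If `β(0) = β'(0) = 0` and `β'' ≥ 0` then `β ≥ 0`. [folklore] -/
private theorem nonneg_of_deriv2_nonneg (hβ : ContDiff ℝ 2 β) (h00 : β 0 = 0) (h0 : deriv β 0 = 0)
    (hnn : ∀ v, 0 ≤ deriv (deriv β) v) (v : ℝ) : 0 ≤ β v := by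
  obtain ⟨hd, hd'⟩ := differentiable_of_contDiff_two hβ
  have hmono : Monotone (deriv β) := monotone_of_deriv_nonneg hd' hnn
  rcases le_total 0 v with hv | hv
  · have hm : MonotoneOn β (Ici 0) :=
      monotoneOn_of_deriv_nonneg (convex_Ici 0) hd.continuous.continuousOn
        (hd.differentiableOn.mono interior_subset) fun x hx => by
          rw [interior_Ici] at hx
          have := hmono hx.le
          rwa [h0] at this
    have := hm (self_mem_Ici (a := (0 : ℝ))) (show v ∈ Ici (0 : ℝ) from hv) hv
    rwa [h00] at this
  · have hm : AntitoneOn β (Iic 0) :=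
      antitoneOn_of_deriv_nonpos (convex_Iic 0) hd.continuous.continuousOn
        (hd.differentiableOn.mono interior_subset) fun x hx => by
          rw [interior_Iic] at hx
          have := hmono hx.le
          rwa [h0] at this
    have := hm (show v ∈ Iic (0 : ℝ) from hv) (self_mem_Iic (a := (0 : ℝ))) hv
    rwa [h00] at this

/-- Chain rule: `D(β ∘ G)(x) w = β'(G x) · DG(x) w`. [folklore] -/
private theorem fderiv_comp_apply {G : EuclideanSpace ℝ (Fin 3) → ℝ} (hβ : Differentiable ℝ β)
    (hG : Differentiable ℝ G) (x w : EuclideanSpace ℝ (Fin 3)) :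
    fderiv ℝ (fun y => β (G y)) x w = deriv β (G x) * fderiv ℝ G x w := by
  have h := ((hβ (G x)).hasDerivAt.comp_hasFDerivAt x (hG x).hasFDerivAt)
  rw [show (fun y => β (G y)) = β ∘ G from rfl, h.fderiv]
  simp [smul_eq_mul]

end Convex

/-! ### `‖DG(x)‖² = Σᵢ (∂ᵢG(x))²` for a scalar function on `ℝ³` -/

/-- For a linear functional on `ℝ³`, `‖L‖² = ∑ᵢ L(eᵢ)²` (Riesz). [folklore] -/
private theorem norm_sq_eq_sum_sq_apply_single (L : EuclideanSpace ℝ (Fin 3) →L[ℝ] ℝ) :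
    ‖L‖ ^ 2 = ∑ i : Fin 3, (L (EuclideanSpace.single i (1 : ℝ))) ^ 2 := by
  set v : EuclideanSpace ℝ (Fin 3) := (InnerProductSpace.toDual ℝ (EuclideanSpace ℝ (Fin 3))).symm L
    with hv
  have hL : ∀ w, L w = ⟪v, w⟫ := fun w => by rw [hv, InnerProductSpace.toDual_symm_apply]
  have hn : ‖L‖ = ‖v‖ := by rw [hv, LinearIsometryEquiv.norm_map]
  rw [hn, EuclideanSpace.real_norm_sq_eq]
  refine Finset.sum_congr rfl fun i _ => ?_
  rw [hL, EuclideanSpace.inner_single_right]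
  simp

/-- `‖DG(x)‖² = (∂₀G)² + (∂₁G)² + (∂₂G)²`. [folklore] -/
private theorem norm_fderiv_sq_eq (G : EuclideanSpace ℝ (Fin 3) → ℝ) (x : EuclideanSpace ℝ (Fin 3)) :
    ‖fderiv ℝ G x‖ ^ 2 =
      fderiv ℝ G x (EuclideanSpace.single 0 1) ^ 2 + fderiv ℝ G x (EuclideanSpace.single 1 1) ^ 2 +
        fderiv ℝ G x (EuclideanSpace.single 2 1) ^ 2 := by
  rw [norm_sq_eq_sum_sq_apply_single, Fin.sum_univ_three]

end AxisymNoSwirlLpDissipation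

open AxisymNoSwirlLpDissipation

/-! ### The fixed-time inequality with dissipation for a convex functional of a drift–Laplacian scalar -/

section Slice

variable {G G' R : EuclideanSpace ℝ (Fin 3) → ℝ}
  {b : EuclideanSpace ℝ (Fin 3) → EuclideanSpace ℝ (Fin 3)} {ν K F : ℝ} {β : ℝ → ℝ}

/-- `β'(G) ∈ L²` when `|β'(v)| ≤ K|v|` on the range of the bounded continuous `G ∈ L²`. [folklore] -/
private theorem memLp_deriv_comp_of_abs_le (hβ : ContDiff ℝ 2 β) (h0 : deriv β 0 = 0)
    (hK : ∀ v, |v| ≤ F → |deriv (deriv β) v| ≤ K) (hGF : ∀ x, |G x| ≤ F) (hGc : Continuous G)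
    (hG : MemLp G 2 volume) : MemLp (fun x => deriv β (G x)) 2 volume := by
  obtain ⟨-, hd'⟩ := differentiable_of_contDiff_two hβ
  refine MemLp.of_le_mul (c := K) hG (hd'.continuous.comp hGc).aestronglyMeasurable
    (Eventually.of_forall fun x => ?_)
  rw [Real.norm_eq_abs, Real.norm_eq_abs]
  exact abs_deriv_le_mul_abs hβ h0 hK (hGF x)

/-- `β(G) ∈ L¹` when `|β(v)| ≤ K v²` on the range of the bounded continuous `G ∈ L²`. [folklore] -/
private theorem integrable_comp_of_abs_le (hβ : ContDiff ℝ 2 β) (h00 : β 0 = 0) (h0 : deriv β 0 = 0)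
    (hK : ∀ v, |v| ≤ F → |deriv (deriv β) v| ≤ K) (hGF : ∀ x, |G x| ≤ F) (hGc : Continuous G)
    (hG : MemLp G 2 volume) : Integrable (fun x => β (G x)) := by
  obtain ⟨hd, -⟩ := differentiable_of_contDiff_two hβ
  refine (hG.integrable_sq.const_mul K).mono' (hd.continuous.comp hGc).aestronglyMeasurable
    (Eventually.of_forall fun x => ?_)
  rw [Real.norm_eq_abs]
  exact abs_le_mul_sq hβ h00 h0 hK (hGF x)

/-- `β''(G) (∂ᵥG) (∂ᵥG)` is integrable when `β''(G)` is bounded (`|G| ≤ F`, `|β''| ≤ K` on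
`[−F, F]`) and `∂ᵥG ∈ L²`. [folklore] -/
private theorem integrable_deriv_deriv_comp_mul_mul (hβ : ContDiff ℝ 2 β)
    (hK : ∀ v, |v| ≤ F → |deriv (deriv β) v| ≤ K) (hGF : ∀ x, |G x| ≤ F) (hGc : Continuous G)
    (w : EuclideanSpace ℝ (Fin 3)) (h1 : MemLp (fun x => fderiv ℝ G x w) 2 volume) :
    Integrable (fun x => deriv (deriv β) (G x) * (fderiv ℝ G x w * fderiv ℝ G x w)) :=
  (h1.integrable_mul h1).bdd_mul
    ((continuous_deriv_deriv_of_contDiff_two hβ).comp hGc).aestronglyMeasurable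
    (ae_of_all _ fun x => by rw [Real.norm_eq_abs]; exact hK (G x) (hGF x))

/-- **The transport term vanishes**: `∫ β'(G) DG[b] = 0` for a divergence-free `b ∈ C¹` bounded
with bounded derivative, a bounded `G ∈ C¹ ∩ L²` with `∂ᵢG ∈ L²`, and `β ∈ C²` with
`β(0) = β'(0) = 0` (`∫ 1 · D(β∘G)[b] = −∫ D1[b] · β(G) = 0`). [folklore] -/
private theorem integral_deriv_comp_mul_fderiv_apply_eq_zero_of_abs_le (hβ : ContDiff ℝ 2 β)
    (h00 : β 0 = 0) (h0 : deriv β 0 = 0) (hK : ∀ v, |v| ≤ F → |deriv (deriv β) v| ≤ K)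
    (hGF : ∀ x, |G x| ≤ F) (hG : ContDiff ℝ 1 G) (hL2 : MemLp G 2 volume)
    (h1 : ∀ i : Fin 3, MemLp (fun x => fderiv ℝ G x (EuclideanSpace.single i 1)) 2 volume)
    (hb : ContDiff ℝ 1 b) (hdiv : VectorCalculus.IsDivFree b)
    {B : ℝ} (hbB : ∀ x, ‖b x‖ ≤ B) {B' : ℝ} (hDb : ∀ x, ‖fderiv ℝ b x‖ ≤ B') :
    ∫ x, deriv β (G x) * fderiv ℝ G x (b x) = 0 := by
  obtain ⟨hd, -⟩ := differentiable_of_contDiff_two hβ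
  have hGd : Differentiable ℝ G := hG.differentiable one_ne_zero
  have hβG : ContDiff ℝ 1 fun y => β (G y) := (hβ.of_le (by norm_num)).comp hG
  have hchain : ∀ x w, fderiv ℝ (fun y => β (G y)) x w = deriv β (G x) * fderiv ℝ G x w :=
    fun x w => fderiv_comp_apply hd hGd x w
  have hβ'L2 : MemLp (fun x => deriv β (G x)) 2 volume :=
    memLp_deriv_comp_of_abs_le hβ h0 hK hGF hG.continuous hL2
  have h := integral_mul_fderiv_apply_eq_neg_of_isDivFree' (a := fun _ => (1 : ℝ))
    (b := fun y => β (G y)) contDiff_const hβG hb hdiv hbB hDb ?_ ?_ ?_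
  · simpa [hchain] using h
  · simpa only [one_mul] using integrable_comp_of_abs_le hβ h00 h0 hK hGF hG.continuous hL2
  · intro i
    simp
  · intro i
    simp only [one_mul, hchain]
    exact hβ'L2.integrable_mul (h1 i)

/-- **The diffusion term, exactly**: `∫ β'(G) ∂ᵥ∂ᵥG = −∫ β''(G) (∂ᵥG)²` for a bounded `G ∈ C²`
with `G, ∂ᵥG, ∂ᵥ∂ᵥG ∈ L²` and `β ∈ C²` with `β'(0) = 0` (integration by parts; the tree's
`AxisymNoSwirlCoSignedFlux` keeps only the sign of this term). [folklore] -/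
private theorem integral_deriv_comp_mul_fderiv_fderiv_eq_neg (hβ : ContDiff ℝ 2 β)
    (h0 : deriv β 0 = 0) (hK : ∀ v, |v| ≤ F → |deriv (deriv β) v| ≤ K) (hGF : ∀ x, |G x| ≤ F)
    (hG : ContDiff ℝ 2 G) (hL2 : MemLp G 2 volume) (w : EuclideanSpace ℝ (Fin 3))
    (h1 : MemLp (fun x => fderiv ℝ G x w) 2 volume)
    (h2 : MemLp (fun x => fderiv ℝ (fun y => fderiv ℝ G y w) x w) 2 volume) :
    ∫ x, deriv β (G x) * fderiv ℝ (fun y => fderiv ℝ G y w) x w =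
      -∫ x, deriv (deriv β) (G x) * (fderiv ℝ G x w * fderiv ℝ G x w) := by
  obtain ⟨hd, hd'⟩ := differentiable_of_contDiff_two hβ
  have hGd : Differentiable ℝ G := hG.differentiable two_ne_zero
  have hgd : Differentiable ℝ fun y => fderiv ℝ G y w :=
    (contDiff_fderiv_apply_const_succ (n := 1) (by exact_mod_cast hG) _).differentiable one_ne_zero
  have hfd : Differentiable ℝ fun y => deriv β (G y) := hd'.comp hGd
  have hchain : ∀ x, fderiv ℝ (fun y => deriv β (G y)) x w = deriv (deriv β) (G x) * fderiv ℝ G x w :=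
    fun x => fderiv_comp_apply hd' hGd x _
  have hβ'L2 : MemLp (fun x => deriv β (G x)) 2 volume :=
    memLp_deriv_comp_of_abs_le hβ h0 hK hGF hG.continuous hL2
  have hsq := integrable_deriv_deriv_comp_mul_mul hβ hK hGF hG.continuous w h1
  have i1 : Integrable (fun x => fderiv ℝ (fun y => deriv β (G y)) x w * fderiv ℝ G x w) := by
    refine hsq.congr (Eventually.of_forall fun x => ?_)
    simp only [hchain]
    ring
  have i2 : Integrable (fun x => deriv β (G x) * fderiv ℝ (fun y => fderiv ℝ G y w) x w) :=
    hβ'L2.integrable_mul h2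
  have i3 : Integrable (fun x => deriv β (G x) * fderiv ℝ G x w) := hβ'L2.integrable_mul h1
  rw [integral_mul_fderiv_eq_neg_of_differentiable hfd hgd _ i1 i2 i3]
  congr 1
  refine integral_congr_ae (Eventually.of_forall fun x => ?_)
  simp only [hchain x]
  ring

/-- **The fixed-time inequality with dissipation for a convex functional** (pairing the
drift–Laplacian equation with `β'(G)` and keeping the diffusion term). Let `β ∈ C²` with
`β(0) = β'(0) = 0`, `β'' ≥ 0` and `|β''| ≤ K` on `[−F, F]`; `G ∈ C²` an axisymmetric scalar with
`|G| ≤ F` and `G, ∂ᵢG, ∂ᵢ∂ᵢG, radDerivQuot G ∈ L²`; `β'(G) R` integrable; `b ∈ C¹` divergence-free,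
bounded with bounded derivative; `ν ≥ 0`; and pointwise `G' + DG[b] = ν (ΔG + 2 radDerivQuot G) + R`.
Then

  `∫ β'(G) G' + ν ∫ β''(G) ‖DG‖² ≤ ∫ β'(G) R` :

the transport term vanishes, `ν∫β'(G)ΔG = −ν∫β''(G)‖DG‖²` exactly, and the axis term
`2ν∫β'(G)(∂ᵣG)/r ≤ 0` (`IsAxisymmetricScalar.integral_deriv_comp_mul_radDerivQuot_nonpos`). With
`R = 0`, `G = η = ω_θ/r`, `β = v^p` this is Feng–Šverák's
`−dE_p/dt = ∫ p(p−1)η^{p−2}|∇η|² + 4π∫[η^p]_{r=0} dz ≥ ∫ p(p−1)η^{p−2}|∇η|²`.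
[cite: FengSverak2015, proof of Lemma 3.8 (arXiv p. 12, the display for −dE_p/dt); GallaySverak2016, §5 before Lemma 5.2 (arXiv p. 16)] -/
theorem integral_deriv_comp_mul_add_dissipation_le_of_drift_laplacian (hβ : ContDiff ℝ 2 β)
    (h00 : β 0 = 0) (h0 : deriv β 0 = 0) (hnn : ∀ v, 0 ≤ deriv (deriv β) v)
    (hK : ∀ v, |v| ≤ F → |deriv (deriv β) v| ≤ K) (hGF : ∀ x, |G x| ≤ F)
    (hG : ContDiff ℝ 2 G) (hax : IsAxisymmetricScalar G) (hν : 0 ≤ ν) (hL2 : MemLp G 2 volume)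
    (h1 : ∀ i : Fin 3, MemLp (fun x => fderiv ℝ G x (EuclideanSpace.single i 1)) 2 volume)
    (h2 : ∀ i : Fin 3, MemLp (fun x => fderiv ℝ (fun y => fderiv ℝ G y (EuclideanSpace.single i 1)) x
      (EuclideanSpace.single i 1)) 2 volume)
    (hq : MemLp (radDerivQuot G) 2 volume)
    (hR : Integrable (fun x => deriv β (G x) * R x))
    (hb : ContDiff ℝ 1 b) (hdiv : VectorCalculus.IsDivFree b)
    {B : ℝ} (hbB : ∀ x, ‖b x‖ ≤ B) {B' : ℝ} (hDb : ∀ x, ‖fderiv ℝ b x‖ ≤ B')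
    (heq : ∀ x, G' x + fderiv ℝ G x (b x) = ν * ((Δ G) x + 2 * radDerivQuot G x) + R x) :
    (∫ x, deriv β (G x) * G' x) + ν * ∫ x, deriv (deriv β) (G x) * ‖fderiv ℝ G x‖ ^ 2 ≤
      ∫ x, deriv β (G x) * R x := by
  obtain ⟨hd, hd'⟩ := differentiable_of_contDiff_two hβ
  have hG1 : ContDiff ℝ 1 G := hG.of_le (by norm_num)
  have hβ1 : ContDiff ℝ 1 β := hβ.of_le (by norm_num)
  have hβnn : ∀ v, 0 ≤ β v := nonneg_of_deriv2_nonneg hβ h00 h0 hnn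
  have hβ'L2 : MemLp (fun x => deriv β (G x)) 2 volume :=
    memLp_deriv_comp_of_abs_le hβ h0 hK hGF hG.continuous hL2
  -- abbreviations for the coordinate pieces
  set e : Fin 3 → EuclideanSpace ℝ (Fin 3) := fun i => EuclideanSpace.single i 1 with he
  have iJ : ∀ i : Fin 3, Integrable (fun x => deriv β (G x) *
      fderiv ℝ (fun y => fderiv ℝ G y (e i)) x (e i)) := fun i => hβ'L2.integrable_mul (h2 i)
  have iS : ∀ i : Fin 3, Integrable (fun x => deriv (deriv β) (G x) *
      (fderiv ℝ G x (e i) * fderiv ℝ G x (e i))) := fun i =>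
    integrable_deriv_deriv_comp_mul_mul hβ hK hGF hG.continuous (e i) (h1 i)
  have hJ : ∀ i : Fin 3, ∫ x, deriv β (G x) * fderiv ℝ (fun y => fderiv ℝ G y (e i)) x (e i) =
      -∫ x, deriv (deriv β) (G x) * (fderiv ℝ G x (e i) * fderiv ℝ G x (e i)) := fun i =>
    integral_deriv_comp_mul_fderiv_fderiv_eq_neg hβ h0 hK hGF hG hL2 (e i) (h1 i) (h2 i)
  -- the transport term
  have htr := integral_deriv_comp_mul_fderiv_apply_eq_zero_of_abs_le hβ h00 h0 hK hGF hG1 hL2 h1 hb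
    hdiv hbB hDb
  -- the Laplacian term, exactly
  have hlap : ∫ x, deriv β (G x) * (Δ G) x =
      -∫ x, deriv (deriv β) (G x) * ‖fderiv ℝ G x‖ ^ 2 := by
    have hsum : ∫ x, deriv β (G x) * (Δ G) x =
        (∫ x, deriv β (G x) * fderiv ℝ (fun y => fderiv ℝ G y (e 0)) x (e 0)) +
        (∫ x, deriv β (G x) * fderiv ℝ (fun y => fderiv ℝ G y (e 1)) x (e 1)) +
        ∫ x, deriv β (G x) * fderiv ℝ (fun y => fderiv ℝ G y (e 2)) x (e 2) := by
      have i3 : Integrable (fun x =>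
          deriv β (G x) * fderiv ℝ (fun y => fderiv ℝ G y (e 0)) x (e 0) +
          deriv β (G x) * fderiv ℝ (fun y => fderiv ℝ G y (e 1)) x (e 1)) := (iJ 0).add (iJ 1)
      rw [← integral_add (iJ 0) (iJ 1), ← integral_add i3 (iJ 2)]
      refine integral_congr_ae (Eventually.of_forall fun x => ?_)
      beta_reduce
      rw [laplacian_eq_sum_fderiv_fderiv (EuclideanSpace.basisFun (Fin 3) ℝ) hG x]
      simp only [EuclideanSpace.basisFun_apply, Fin.sum_univ_three, he]
      ring
    have hsq : ∫ x, deriv (deriv β) (G x) * ‖fderiv ℝ G x‖ ^ 2 =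
        (∫ x, deriv (deriv β) (G x) * (fderiv ℝ G x (e 0) * fderiv ℝ G x (e 0))) +
        (∫ x, deriv (deriv β) (G x) * (fderiv ℝ G x (e 1) * fderiv ℝ G x (e 1))) +
        ∫ x, deriv (deriv β) (G x) * (fderiv ℝ G x (e 2) * fderiv ℝ G x (e 2)) := by
      have i3 : Integrable (fun x =>
          deriv (deriv β) (G x) * (fderiv ℝ G x (e 0) * fderiv ℝ G x (e 0)) +
          deriv (deriv β) (G x) * (fderiv ℝ G x (e 1) * fderiv ℝ G x (e 1))) := (iS 0).add (iS 1)
      rw [← integral_add (iS 0) (iS 1), ← integral_add i3 (iS 2)]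
      refine integral_congr_ae (Eventually.of_forall fun x => ?_)
      beta_reduce
      rw [norm_fderiv_sq_eq G x]
      simp only [he]
      ring
    rw [hsum, hsq, hJ 0, hJ 1, hJ 2]
    ring
  -- the axis term
  have hax' : ∫ x, deriv β (G x) * radDerivQuot G x ≤ 0 :=
    hax.integral_deriv_comp_mul_radDerivQuot_nonpos hG hβ1 hβnn (hβ'L2.integrable_mul hq)
      (integrable_comp_of_abs_le hβ h00 h0 hK hGF hG.continuous hL2)
  -- integrability of the pieces
  have iL : Integrable (fun x => deriv β (G x) * (Δ G) x) := by
    have i3 : Integrable (fun x =>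
        deriv β (G x) * fderiv ℝ (fun y => fderiv ℝ G y (e 0)) x (e 0) +
        deriv β (G x) * fderiv ℝ (fun y => fderiv ℝ G y (e 1)) x (e 1) +
        deriv β (G x) * fderiv ℝ (fun y => fderiv ℝ G y (e 2)) x (e 2)) := ((iJ 0).add (iJ 1)).add (iJ 2)
    refine i3.congr (Eventually.of_forall fun x => ?_)
    beta_reduce
    rw [laplacian_eq_sum_fderiv_fderiv (EuclideanSpace.basisFun (Fin 3) ℝ) hG x]
    simp only [EuclideanSpace.basisFun_apply, Fin.sum_univ_three, he]
    ring
  have iQ : Integrable (fun x => deriv β (G x) * radDerivQuot G x) := hβ'L2.integrable_mul hq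
  have hbid : ∀ i : Fin 3, Differentiable ℝ fun x => b x i := fun i =>
    (contDiff_apply_coord_vec3 hb i).differentiable one_ne_zero
  have hbiB : ∀ (i : Fin 3) x, ‖b x i‖ ≤ B := fun i x => (PiLp.norm_apply_le (b x) i).trans (hbB x)
  have iA : ∀ i : Fin 3, Integrable
      (fun x => b x i * (deriv β (G x) * fderiv ℝ G x (EuclideanSpace.single i 1))) := fun i =>
    (hβ'L2.integrable_mul (h1 i)).bdd_mul (hbid i).continuous.aestronglyMeasurable
      (ae_of_all _ (hbiB i))
  have iT : Integrable (fun x => deriv β (G x) * fderiv ℝ G x (b x)) := by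
    have i3 : Integrable (fun x => b x 0 * (deriv β (G x) * fderiv ℝ G x (EuclideanSpace.single 0 1)) +
        b x 1 * (deriv β (G x) * fderiv ℝ G x (EuclideanSpace.single 1 1)) +
        b x 2 * (deriv β (G x) * fderiv ℝ G x (EuclideanSpace.single 2 1))) :=
      ((iA 0).add (iA 1)).add (iA 2)
    refine i3.congr (Eventually.of_forall fun x => ?_)
    beta_reduce
    rw [fderiv_apply_eq_sum_three G x (b x)]
    ring
  -- integrate `β'(G) ×` the equation
  have hpt : ∀ x, deriv β (G x) * G' x =
      -(deriv β (G x) * fderiv ℝ G x (b x)) + ν * (deriv β (G x) * (Δ G) x) +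
        2 * ν * (deriv β (G x) * radDerivQuot G x) + deriv β (G x) * R x := by
    intro x
    have h := heq x
    have : G' x = -fderiv ℝ G x (b x) + ν * ((Δ G) x + 2 * radDerivQuot G x) + R x := by linarith
    rw [this]
    ring
  have iTn : Integrable (fun x => -(deriv β (G x) * fderiv ℝ G x (b x))) := iT.neg
  have iLν : Integrable (fun x => ν * (deriv β (G x) * (Δ G) x)) := iL.const_mul ν
  have iQν : Integrable (fun x => 2 * ν * (deriv β (G x) * radDerivQuot G x)) :=
    iQ.const_mul (2 * ν)
  have i12 : Integrable (fun x => -(deriv β (G x) * fderiv ℝ G x (b x)) +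
      ν * (deriv β (G x) * (Δ G) x)) := iTn.add iLν
  have i123 : Integrable (fun x => -(deriv β (G x) * fderiv ℝ G x (b x)) +
      ν * (deriv β (G x) * (Δ G) x) + 2 * ν * (deriv β (G x) * radDerivQuot G x)) := i12.add iQν
  have hint : ∫ x, deriv β (G x) * G' x =
      -(∫ x, deriv β (G x) * fderiv ℝ G x (b x)) + ν * (∫ x, deriv β (G x) * (Δ G) x) +
        2 * ν * (∫ x, deriv β (G x) * radDerivQuot G x) + ∫ x, deriv β (G x) * R x := by
    rw [integral_congr_ae (Eventually.of_forall hpt), integral_add i123 hR, integral_add i12 iQν,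
      integral_add iTn iLν, integral_neg, integral_const_mul, integral_const_mul]
  rw [hint, htr, hlap]
  nlinarith [mul_nonpos_iff.2 (Or.inl ⟨hν, hax'⟩)]

end Slice

/-! ### Tao's class: the slice inequality and the balance with dissipation for `β(ω_θ/r)` -/

section TaoClass

variable {T ν : ℝ} {u₀ : EuclideanSpace ℝ (Fin 3) → EuclideanSpace ℝ (Fin 3)}
  {v : ℝ → EuclideanSpace ℝ (Fin 3) → EuclideanSpace ℝ (Fin 3)} {q : ℝ → EuclideanSpace ℝ (Fin 3) → ℝ}
  {β : ℝ → ℝ}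

/-- Without swirl `u^θ/r ≡ 0`: `angVelQuot u = 0` when `swirl u ≡ 0`. [folklore] -/
private theorem angVelQuot_eq_zero_of_hasNoSwirl' {u : EuclideanSpace ℝ (Fin 3) → EuclideanSpace ℝ (Fin 3)}
    (hsw : HasNoSwirl u) : angVelQuot u = 0 := by
  have h0 : swirl u = fun _ => 0 := funext fun x => hsw x
  funext x
  simp only [angVelQuot, h0, Pi.zero_apply]
  have h1 : radDerivQuot (fun _ : EuclideanSpace ℝ (Fin 3) => (0 : ℝ)) = fun _ => 0 := by
    funext y
    simp [radDerivQuot, hadamardQuotFst]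
  simp [radQuot, h1]

/-- **`η = ω_θ/r` is bounded on the slab in Tao's class**: `|angVortQuot (v t) x| ≤ F` for all
`t ∈ [0, T]`, `x`, when the slices are axisymmetric (`|ω_θ/r| ≤ ‖D curl v‖ ≤ ‖curlCLM‖ ‖D²v‖`,
bounded on the slab by the Sobolev imbedding `H²(ℝ³) ⊂ L^∞` applied to `D²v ∈ L^∞_t H^k_x`, as in the
tree's `IsTaoSolutionOn.exists_bound_fderiv_fderiv`). [cite: AdamsFournier2003, Thm. 4.12 Part I Case A (mp > n)] -/
theorem IsTaoSolutionOn.exists_forall_abs_angVortQuot_le (h : IsTaoSolutionOn T ν u₀ v q)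
    (hax : ∀ t ∈ Icc 0 T, IsAxisymmetric (v t)) :
    ∃ F : ℝ, 0 ≤ F ∧ ∀ t ∈ Icc 0 T, ∀ x, |angVortQuot (v t) x| ≤ F := by
  have hvs : ∀ t ∈ Icc 0 T, ContDiff ℝ ∞ (v t) := fun t ht => h.classical.contDiff_velocity ht
  obtain ⟨B, hB0, hB⟩ := h.sobolev.exists_forall_norm_iteratedFDeriv_le hvs 2
  refine ⟨‖curlCLM‖ * B, mul_nonneg (norm_nonneg curlCLM) hB0, fun t ht x => ?_⟩
  have hv2 : ContDiff ℝ 2 (v t) := (hvs t ht).of_le (by norm_cast)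
  have hv3 : ContDiff ℝ 3 (v t) := (hvs t ht).of_le (by norm_cast)
  calc |angVortQuot (v t) x| ≤ ‖fderiv ℝ (curl (v t)) x‖ :=
        (hax t ht).abs_angVortQuot_le_norm_fderiv_curl hv3 x
    _ ≤ ‖curlCLM‖ * ‖iteratedFDeriv ℝ 2 (v t) x‖ := norm_fderiv_curl_le hv2 x
    _ ≤ ‖curlCLM‖ * B := mul_le_mul_of_nonneg_left (hB t ht x) (norm_nonneg curlCLM)

/-- **The slice inequality with dissipation in Tao's class.** For a Tao-class solution on `[0, T]`
with `ν ≥ 0` whose slices are axisymmetric without swirl, `β ∈ C²` with `β(0) = β'(0) = 0`,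
`β'' ≥ 0`, and `t ∈ [0, T]`:
`∫ β'(η(t)) η'(t) dx + ν ∫ β''(η(t)) ‖∇η(t)‖² dx ≤ 0`, where `η(t) = angVortQuot (v t) = ω_θ/r`
and `η'(t) = angVortQuot (∂ₜv t)` (the `η`-equation `IsClassicalNSSolutionOn.angVortQuot_eq` has no
source without swirl; `η` is bounded on the slab, so `β''(η)` is bounded; all `L²` data from
`IsTaoSolutionOn.memLp_angVortQuot_data`). This is Feng–Šverák's
`−dE_p/dt ≥ ∫ p(p−1) η^{p−2}|∇η|²` for a general convex `β` in place of `v^p`.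
[cite: FengSverak2015, proof of Lemma 3.8 (arXiv p. 12); GallaySverak2016, §5 Lemma 5.2 (arXiv p. 16)] -/
theorem IsTaoSolutionOn.integral_deriv_comp_mul_angVortQuot_add_dissipation_nonpos
    (h : IsTaoSolutionOn T ν u₀ v q) (hT : 0 < T) (hν : 0 ≤ ν)
    (hax : ∀ t ∈ Icc 0 T, IsAxisymmetric (v t)) (hsw : ∀ t ∈ Icc 0 T, HasNoSwirl (v t))
    (hβ : ContDiff ℝ 2 β) (h00 : β 0 = 0) (h0 : deriv β 0 = 0)
    (hnn : ∀ w, 0 ≤ deriv (deriv β) w) {t : ℝ} (ht : t ∈ Icc 0 T) :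
    (∫ x, deriv β (angVortQuot (v t) x) * angVortQuot (timeDerivWithin (Icc 0 T) v t) x) +
      ν * ∫ x, deriv (deriv β) (angVortQuot (v t) x) * ‖fderiv ℝ (angVortQuot (v t)) x‖ ^ 2 ≤ 0 := by
  have hU : UniqueDiffOn ℝ (Icc 0 T) := uniqueDiffOn_Icc hT
  have hcl := Icc_subset_closure_interior_Icc' hT
  obtain ⟨F, -, hF⟩ := h.exists_forall_abs_angVortQuot_le hax
  obtain ⟨K, -, hK⟩ := exists_abs_deriv_deriv_le hβ F
  have hvs : ContDiff ℝ ∞ (v t) := h.classical.contDiff_velocity ht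
  have hv1 : ContDiff ℝ 1 (v t) := hvs.of_le (by norm_cast)
  have hv3 : ContDiff ℝ 3 (v t) := hvs.of_le (by norm_cast)
  have hΩ2 : ContDiff ℝ 2 (angVortQuot (v t)) :=
    contDiff_angVortQuot (n := 2) (by exact_mod_cast hvs.of_le (by norm_cast))
  have hΩax : IsAxisymmetricScalar (angVortQuot (v t)) := (hax t ht).isAxisymmetricScalar_angVortQuot hv3
  obtain ⟨m0, m1, m2, mq⟩ := h.memLp_angVortQuot_data hax ht
  obtain ⟨B, -, hB⟩ := exists_bound_velocity h
  obtain ⟨B', -, hB'⟩ := h.exists_bound_fderiv_velocity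
  have hΦ0 : angVelQuot (v t) = 0 := angVelQuot_eq_zero_of_hasNoSwirl' (hsw t ht)
  have heq : ∀ x, angVortQuot (timeDerivWithin (Icc 0 T) v t) x +
      fderiv ℝ (angVortQuot (v t)) x (v t x) =
      ν * ((Δ (angVortQuot (v t))) x + 2 * radDerivQuot (angVortQuot (v t)) x) + (fun _ => (0 : ℝ)) x :=
    fun x => by
      rw [h.classical.angVortQuot_eq hU hcl hax ht x, hΦ0]
      simp
  have hR : Integrable (fun x => deriv β (angVortQuot (v t) x) * (fun _ => (0 : ℝ)) x) := by
    simp only [mul_zero]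
    exact integrable_zero _ _ _
  have hmain := integral_deriv_comp_mul_add_dissipation_le_of_drift_laplacian hβ h00 h0 hnn hK
    (hF t ht) hΩ2 hΩax hν m0 m1 m2 mq hR hv1 (h.classical.divFree t ht) (hB t ht) (hB' t ht) heq
  simpa using hmain

/-- **The dissipation time-function is integrable.** Along a Tao-class solution with axisymmetric
slices and `β ∈ C²`, `τ ↦ ∫ β''(η(τ)) ‖∇η(τ)‖² dx` is integrable on `(0, T)`: the integrand is
jointly continuous, `β''(η) ≤ K` on the slab, and `∫ ‖∇η(τ)‖² ≤ C` uniformly (Fubini) — the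
time-integrability of Feng–Šverák's dissipation `∫ p(p−1)η^{p−2}|∇η|² dx`, which they integrate over
`(0, t)`. [cite: FengSverak2015, proof of Lemma 3.8 (arXiv p. 12, time integration of the display for −dE_p/dt)] -/
theorem IsTaoSolutionOn.integrableOn_integral_deriv_deriv_comp_mul_norm_fderiv_sq
    (h : IsTaoSolutionOn T ν u₀ v q) (hT : 0 < T) (hax : ∀ t ∈ Icc 0 T, IsAxisymmetric (v t))
    (hβ : ContDiff ℝ 2 β) :
    IntegrableOn (fun τ => ∫ x, deriv (deriv β) (angVortQuot (v τ) x) *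
      ‖fderiv ℝ (angVortQuot (v τ)) x‖ ^ 2) (Ioo 0 T) := by
  have hU : UniqueDiffOn ℝ (Icc 0 T) := uniqueDiffOn_Icc hT
  have hsm : IsSmoothSpaceTimeOn (Icc 0 T) v := h.classical.smooth_velocity
  have hvs : ∀ t ∈ Icc 0 T, ContDiff ℝ ∞ (v t) := fun t ht => h.classical.contDiff_velocity ht
  obtain ⟨F, -, hF⟩ := h.exists_forall_abs_angVortQuot_le hax
  obtain ⟨K, hK0, hK⟩ := exists_abs_deriv_deriv_le hβ F
  -- joint smoothness of `η` and of its slice gradients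
  have hΩ : IsSmoothSpaceTimeOn (Icc 0 T) (fun t => angVortQuot (v t)) :=
    hsm.angVortQuot_family (convex_Icc 0 T) hU
  have hDΩ : IsSmoothSpaceTimeOn (Icc 0 T) (fun t x => fderiv ℝ (angVortQuot (v t)) x) :=
    hΩ.fderiv_slice hU
  -- uniform `L²` bound of `∇η`
  obtain ⟨C₁, hC₁⟩ := exists_lintegral_sq_iteratedFDeriv_angVortQuot_le hvs hax h.sobolev 1
  have hgrad : ∀ τ ∈ Icc 0 T, ∫⁻ x, ‖fderiv ℝ (angVortQuot (v τ)) x‖ₑ ^ 2 ≤ C₁ := by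
    intro τ hτ
    refine le_of_eq_of_le (lintegral_congr fun x => ?_) (hC₁ τ hτ)
    rw [← ofReal_norm, ← ofReal_norm, ← norm_iteratedFDeriv_zero (𝕜 := ℝ)
      (f := fderiv ℝ (angVortQuot (v τ))), norm_iteratedFDeriv_fderiv]
  -- the integrand as a function on `(0,T) × ℝ³`
  set Φ : ℝ × EuclideanSpace ℝ (Fin 3) → ℝ := uncurry fun τ x =>
    deriv (deriv β) (angVortQuot (v τ) x) * ‖fderiv ℝ (angVortQuot (v τ)) x‖ ^ 2 with hΦ
  have hmeas : AEStronglyMeasurable Φ ((volume.restrict (Ioo 0 T)).prod volume) := by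
    refine aestronglyMeasurable_prod_of_continuousOn_off_axis ?_
    have hsub : Ioo 0 T ×ˢ {x : EuclideanSpace ℝ (Fin 3) | cylRadius x ≠ 0} ⊆ Icc 0 T ×ˢ univ :=
      prod_mono Ioo_subset_Icc_self (subset_univ _)
    have c1 : ContinuousOn (fun p : ℝ × EuclideanSpace ℝ (Fin 3) =>
        deriv (deriv β) (uncurry (fun t x => angVortQuot (v t) x) p)) (Icc 0 T ×ˢ univ) :=
      (continuous_deriv_deriv_of_contDiff_two hβ).comp_continuousOn hΩ.continuousOn
    have c2 : ContinuousOn (fun p : ℝ × EuclideanSpace ℝ (Fin 3) =>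
        ‖uncurry (fun t x => fderiv ℝ (angVortQuot (v t)) x) p‖ ^ 2) (Icc 0 T ×ˢ univ) :=
      (hDΩ.continuousOn.norm).pow 2
    exact ((c1.mul c2).mono hsub).congr fun p _ => by obtain ⟨τ, x⟩ := p; simp [hΦ]
  have hI : Integrable Φ ((volume.restrict (Ioo 0 T)).prod volume) := by
    refine ⟨hmeas, ?_⟩
    have hle := lintegral_prod_le (μ := volume.restrict (Ioo 0 T)) (ν := volume)
      (fun z : ℝ × EuclideanSpace ℝ (Fin 3) => ‖Φ z‖ₑ)
    refine lt_of_le_of_lt hle ?_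
    have hslice : ∀ τ ∈ Ioo 0 T, ∫⁻ x, ‖Φ (τ, x)‖ₑ ≤ ENNReal.ofReal K * C₁ := by
      intro τ hτ
      have hτI : τ ∈ Icc 0 T := Ioo_subset_Icc_self hτ
      calc ∫⁻ x, ‖Φ (τ, x)‖ₑ
          ≤ ∫⁻ x, ENNReal.ofReal K * ‖fderiv ℝ (angVortQuot (v τ)) x‖ₑ ^ 2 := by
            refine lintegral_mono fun x => ?_
            simp only [hΦ, uncurry_apply_pair]
            rw [enorm_mul]
            refine mul_le_mul' ?_ (le_of_eq ?_)
            · rw [Real.enorm_eq_ofReal_abs]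
              exact ENNReal.ofReal_le_ofReal (hK _ (hF τ hτI x))
            · rw [Real.enorm_eq_ofReal (sq_nonneg _), ENNReal.ofReal_pow (norm_nonneg _), ofReal_norm]
        _ = ENNReal.ofReal K * ∫⁻ x, ‖fderiv ℝ (angVortQuot (v τ)) x‖ₑ ^ 2 :=
            lintegral_const_mul' _ _ ENNReal.ofReal_ne_top
        _ ≤ ENNReal.ofReal K * C₁ := by gcongr; exact hgrad τ hτI
    calc ∫⁻ τ in Ioo 0 T, ∫⁻ x, ‖Φ (τ, x)‖ₑ
        ≤ ∫⁻ _ in Ioo 0 T, ENNReal.ofReal K * C₁ := setLIntegral_mono' measurableSet_Ioo hslice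
      _ < ⊤ := by
          rw [setLIntegral_const]
          exact ENNReal.mul_lt_top (ENNReal.mul_lt_top ENNReal.ofReal_lt_top ENNReal.coe_lt_top)
            (by simp)
  have := hI.integral_prod_left
  simp only [hΦ, uncurry_apply_pair] at this
  exact this

/-- **The `L^p`-type balance with dissipation for convex functionals of `ω_θ/r`** (the time
integration of the slice inequality). Let `(v, q)` be a Tao-class solution of the unforced
Navier–Stokes system on `[0, T] × ℝ³` with viscosity `ν ≥ 0`, axisymmetric without swirl at every
time, and `β ∈ C²` with `β(0) = β'(0) = 0`, `β'' ≥ 0`. Then for `0 ≤ s ≤ t ≤ T`, with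
`η(τ) = angVortQuot (v τ) = ω_θ/r`,

  `∫ β(η(t, x)) dx + ν ∫_{τ ∈ s..t} ∫ β''(η(τ, x)) ‖∇η(τ, x)‖² dx dτ ≤ ∫ β(η(s, x)) dx`

(Feng–Šverák's `E_p(t) + ∫ₛᵗ∫ p(p−1)η^{p−2}|∇η|² ≤ E_p(s)` for `β = v^p`; the sourced balance
`integral_comp_le_add_intervalIntegral_of_ae_hasDerivAt` of the tree with majorant
`−ν∫β''(η)‖∇η‖²`, `η` jointly smooth with uniform `L²` bounds of `η, ∂ₜη, ∇η`).
[cite: FengSverak2015, proof of Lemma 3.8 (arXiv p. 12); GallaySverak2016, §5 Lemma 5.2 (arXiv p. 16)] -/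
theorem IsTaoSolutionOn.integral_comp_angVortQuot_add_dissipation_le (h : IsTaoSolutionOn T ν u₀ v q)
    (hT : 0 < T) (hν : 0 ≤ ν) (hax : ∀ t ∈ Icc 0 T, IsAxisymmetric (v t))
    (hsw : ∀ t ∈ Icc 0 T, HasNoSwirl (v t))
    (hβ : ContDiff ℝ 2 β) (h00 : β 0 = 0) (h0 : deriv β 0 = 0)
    (hnn : ∀ w, 0 ≤ deriv (deriv β) w) {s t : ℝ} (hs : s ∈ Icc 0 T) (ht : t ∈ Icc 0 T)
    (hst : s ≤ t) :
    (∫ x, β (angVortQuot (v t) x)) +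
      ν * ∫ τ in s..t, ∫ x, deriv (deriv β) (angVortQuot (v τ) x) *
        ‖fderiv ℝ (angVortQuot (v τ)) x‖ ^ 2 ≤ ∫ x, β (angVortQuot (v s) x) := by
  have hU : UniqueDiffOn ℝ (Icc 0 T) := uniqueDiffOn_Icc hT
  have hcl := Icc_subset_closure_interior_Icc' hT
  obtain ⟨F, -, hF⟩ := h.exists_forall_abs_angVortQuot_le hax
  obtain ⟨K, hK0, hK⟩ := exists_abs_deriv_deriv_le hβ F
  obtain ⟨hd, hd'⟩ := differentiable_of_contDiff_two hβ
  have hβ1 : ContDiff ℝ 1 β := hβ.of_le (by norm_num)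
  have hsm : IsSmoothSpaceTimeOn (Icc 0 T) v := h.classical.smooth_velocity
  have hvs : ∀ t ∈ Icc 0 T, ContDiff ℝ ∞ (v t) := fun t ht => h.classical.contDiff_velocity ht
  have hΩc : ∀ t ∈ Icc 0 T, Continuous (angVortQuot (v t)) := fun t ht =>
    (contDiff_angVortQuot (n := 0) (by exact_mod_cast (hvs t ht).of_le (by norm_cast))).continuous
  -- the jointly smooth family `η` and its time derivative
  have hΩ : IsSmoothSpaceTimeOn (Icc 0 T) (fun t => angVortQuot (v t)) :=
    hsm.angVortQuot_family (convex_Icc 0 T) hU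
  have hΩ' : IsSmoothSpaceTimeOn (Icc 0 T) (timeDerivWithin (Icc 0 T) fun t => angVortQuot (v t)) :=
    hΩ.timeDerivWithin hU
  have hdt : ∀ t ∈ Icc 0 T, ∀ x, timeDerivWithin (Icc 0 T) (fun s => angVortQuot (v s)) t x =
      angVortQuot (timeDerivWithin (Icc 0 T) v t) x := fun t ht x =>
    hsm.timeDerivWithin_angVortQuot (convex_Icc 0 T) hU hcl hax ht x
  have tl : ∀ {w : ℝ → EuclideanSpace ℝ (Fin 3) → ℝ},
      ContinuousOn (uncurry w) (Icc 0 T ×ˢ univ) → ∀ x, ContinuousOn (fun s => w s x) (Icc 0 T) := by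
    intro w hw x
    exact hw.comp (continuous_id.prodMk continuous_const).continuousOn
      fun s hs => mk_mem_prod hs (mem_univ x)
  -- uniform `L²` bounds of `η`, `η'`
  obtain ⟨C, hC⟩ := h.exists_lintegral_sq_quot_le hT hax
  -- the dissipation majorant
  have hDint := h.integrableOn_integral_deriv_deriv_comp_mul_norm_fderiv_sq hT hax hβ
  -- (i) time lines
  have hline : ∀ᵐ x ∂(volume : Measure (EuclideanSpace ℝ (Fin 3))),
      ContinuousOn (fun t => angVortQuot (v t) x) (Icc 0 T) ∧
      ContinuousOn (fun t => angVortQuot (timeDerivWithin (Icc 0 T) v t) x) (Icc 0 T) ∧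
      ∀ t ∈ Ioo 0 T, HasDerivAt (fun t => angVortQuot (v t) x)
        (angVortQuot (timeDerivWithin (Icc 0 T) v t) x) t := by
    refine ae_of_all _ fun x => ⟨tl hΩ.continuousOn x, (tl hΩ'.continuousOn x).congr fun s hs =>
      (hdt s hs x).symm, fun t ht => ?_⟩
    have htI : t ∈ Icc 0 T := Ioo_subset_Icc_self ht
    have h1 : HasDerivWithinAt (fun s => angVortQuot (v s) x)
        (timeDerivWithin (Icc 0 T) (fun s => angVortQuot (v s)) t x) (Icc 0 T) t := by
      rw [timeDerivWithin_apply]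
      exact (hΩ.differentiableWithinAt_time htI x).hasDerivWithinAt
    rw [hdt t htI x] at h1
    exact h1.hasDerivAt (Icc_mem_nhds ht.1 ht.2)
  -- (ii) joint measurability of `β'(η) η'`
  have hmeas : AEStronglyMeasurable (uncurry fun t x => deriv β (angVortQuot (v t) x) *
      angVortQuot (timeDerivWithin (Icc 0 T) v t) x) ((volume.restrict (Ioo 0 T)).prod volume) := by
    refine aestronglyMeasurable_prod_of_continuousOn_off_axis ?_
    have hsub : Ioo 0 T ×ˢ {x : EuclideanSpace ℝ (Fin 3) | cylRadius x ≠ 0} ⊆ Icc 0 T ×ˢ univ :=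
      prod_mono Ioo_subset_Icc_self (subset_univ _)
    have c1 : ContinuousOn (fun p : ℝ × EuclideanSpace ℝ (Fin 3) => deriv β (uncurry (fun t x =>
        angVortQuot (v t) x) p)) (Icc 0 T ×ˢ univ) := hd'.continuous.comp_continuousOn hΩ.continuousOn
    have c2 : ContinuousOn (uncurry (timeDerivWithin (Icc 0 T) fun t => angVortQuot (v t)))
        (Icc 0 T ×ˢ univ) := hΩ'.continuousOn
    refine ((c1.mul c2).mono hsub).congr fun p hp => ?_
    obtain ⟨t, x⟩ := p
    have htI : t ∈ Icc 0 T := Ioo_subset_Icc_self hp.1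
    simp only [Pi.mul_apply, uncurry_apply_pair]
    rw [hdt t htI x]
  -- (iii) uniform `L¹` bound of `β'(η) η'`
  have hbound : ∀ t ∈ Ioo 0 T, ∫⁻ x, ‖deriv β (angVortQuot (v t) x) *
      angVortQuot (timeDerivWithin (Icc 0 T) v t) x‖ₑ ≤ ENNReal.ofReal K * ((C : ℝ≥0∞) + C) := by
    intro t ht
    have htI : t ∈ Icc 0 T := Ioo_subset_Icc_self ht
    obtain ⟨hΩC, hΩ'C, -, -⟩ := hC t htI
    calc ∫⁻ x, ‖deriv β (angVortQuot (v t) x) * angVortQuot (timeDerivWithin (Icc 0 T) v t) x‖ₑ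
        ≤ ∫⁻ x, ENNReal.ofReal K * (‖angVortQuot (v t) x‖ₑ ^ 2 +
            ‖angVortQuot (timeDerivWithin (Icc 0 T) v t) x‖ₑ ^ 2) := by
          refine lintegral_mono fun x => ?_
          rw [enorm_mul]
          calc ‖deriv β (angVortQuot (v t) x)‖ₑ * ‖angVortQuot (timeDerivWithin (Icc 0 T) v t) x‖ₑ
              ≤ (ENNReal.ofReal K * ‖angVortQuot (v t) x‖ₑ) *
                  ‖angVortQuot (timeDerivWithin (Icc 0 T) v t) x‖ₑ := by
                gcongr
                have hb := abs_deriv_le_mul_abs hβ h0 hK (hF t htI x)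
                rw [← Real.enorm_eq_ofReal hK0, ← enorm_mul, Real.enorm_eq_ofReal_abs,
                  Real.enorm_eq_ofReal_abs, abs_mul, abs_of_nonneg hK0]
                exact ENNReal.ofReal_le_ofReal hb
            _ = ENNReal.ofReal K * (‖angVortQuot (v t) x‖ₑ *
                  ‖angVortQuot (timeDerivWithin (Icc 0 T) v t) x‖ₑ) := mul_assoc _ _ _
            _ ≤ ENNReal.ofReal K * (‖angVortQuot (v t) x‖ₑ ^ 2 +
                  ‖angVortQuot (timeDerivWithin (Icc 0 T) v t) x‖ₑ ^ 2) := by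
                gcongr
                exact ennreal_mul_le_sq_add_sq _ _
      _ = ENNReal.ofReal K * ((∫⁻ x, ‖angVortQuot (v t) x‖ₑ ^ 2) +
            ∫⁻ x, ‖angVortQuot (timeDerivWithin (Icc 0 T) v t) x‖ₑ ^ 2) := by
          have hmΩ : Measurable fun x => ‖angVortQuot (v t) x‖ₑ ^ 2 :=
            (hΩc t htI).measurable.enorm.pow_const 2
          rw [lintegral_const_mul' _ _ ENNReal.ofReal_ne_top, lintegral_add_left hmΩ]
      _ ≤ ENNReal.ofReal K * ((C : ℝ≥0∞) + C) := by gcongr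
  -- (iv) slices `β(η(t))` are integrable
  have hint : ∀ t ∈ Icc 0 T, Integrable (fun x => β (angVortQuot (v t) x)) := by
    intro t ht
    obtain ⟨m0, -, -, -⟩ := h.memLp_angVortQuot_data hax ht
    exact integrable_comp_of_abs_le hβ h00 h0 hK (hF t ht) (hΩc t ht) m0
  -- (v) the slice inequality with the dissipation as (negative) majorant
  have hle : ∀ t ∈ Ioo 0 T, ∫ x, deriv β (angVortQuot (v t) x) *
      angVortQuot (timeDerivWithin (Icc 0 T) v t) x ≤
      (fun τ => -ν * ∫ x, deriv (deriv β) (angVortQuot (v τ) x) *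
        ‖fderiv ℝ (angVortQuot (v τ)) x‖ ^ 2) t := by
    intro t ht
    have := h.integral_deriv_comp_mul_angVortQuot_add_dissipation_nonpos hT hν hax hsw hβ h00 h0 hnn
      (Ioo_subset_Icc_self ht)
    simp only
    linarith
  have key := integral_comp_le_add_intervalIntegral_of_ae_hasDerivAt (μ := volume) (T := T) hβ1 hline
    hmeas (ENNReal.mul_ne_top ENNReal.ofReal_ne_top (by simp)) hbound hint (hDint.const_mul (-ν)) hle
    hs ht hst
  rw [intervalIntegral.integral_const_mul] at key
  linarith

/-- **The balance with dissipation from the datum.** For a Tao-class solution `(v, q)` on `[0, T]`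
(`0 < T`) of the unforced Navier–Stokes system with `ν > 0` whose datum `u₀` is axisymmetric
WITHOUT swirl (the solution then stays so), `β ∈ C²` with `β(0) = β'(0) = 0`, `β'' ≥ 0`, and
`0 ≤ s ≤ t ≤ T`: `∫ β(η(t)) + ν∫ₛᵗ∫ β''(η)‖∇η‖² ≤ ∫ β(η(s))`, `η = ω_θ/r`.
[cite: FengSverak2015, proof of Lemma 3.8 (arXiv p. 12); GallaySverak2016, §5 Lemma 5.2 (arXiv p. 16)] -/
theorem IsTaoSolutionOn.integral_comp_angVortQuot_add_dissipation_le_of_datum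
    (h : IsTaoSolutionOn T ν u₀ v q) (hT : 0 < T) (hν : 0 < ν) (h₀ : IsAxisymmetric u₀)
    (h₀' : HasNoSwirl u₀) (hβ : ContDiff ℝ 2 β) (h00 : β 0 = 0) (h0 : deriv β 0 = 0)
    (hnn : ∀ w, 0 ≤ deriv (deriv β) w) {s t : ℝ} (hs : s ∈ Icc 0 T) (ht : t ∈ Icc 0 T)
    (hst : s ≤ t) :
    (∫ x, β (angVortQuot (v t) x)) +
      ν * ∫ τ in s..t, ∫ x, deriv (deriv β) (angVortQuot (v τ) x) *
        ‖fderiv ℝ (angVortQuot (v τ)) x‖ ^ 2 ≤ ∫ x, β (angVortQuot (v s) x) :=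
  h.integral_comp_angVortQuot_add_dissipation_le hT hν.le (h.isAxisymmetric hν hT h₀)
    (h.hasNoSwirl hν hT h₀ h₀') hβ h00 h0 hnn hs ht hst

end TaoClass

/-! ### Powers: `β(v) = v^{2k}` — Feng–Šverák's `E_p(t) + ν p(p−1)∫ₛᵗ∫ η^{p−2}|∇η|² ≤ E_p(s)` -/

section Powers

variable {T ν : ℝ} {u₀ : EuclideanSpace ℝ (Fin 3) → EuclideanSpace ℝ (Fin 3)}
  {v : ℝ → EuclideanSpace ℝ (Fin 3) → EuclideanSpace ℝ (Fin 3)} {q : ℝ → EuclideanSpace ℝ (Fin 3) → ℝ}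

/-- Calculus of `β(v) = v^{2k}`, `k ≥ 1`: `β ∈ C²`, `β(0) = β'(0) = 0`,
`β'' (v) = 2k(2k−1) v^{2k−2} ≥ 0`. [folklore] -/
private theorem pow_even_data {k : ℕ} (hk : 1 ≤ k) :
    ContDiff ℝ 2 (fun v : ℝ => v ^ (2 * k)) ∧ (0 : ℝ) ^ (2 * k) = 0 ∧
      deriv (fun v : ℝ => v ^ (2 * k)) 0 = 0 ∧
      (deriv (deriv fun v : ℝ => v ^ (2 * k)) =
        fun v => (2 * k : ℝ) * (2 * k - 1 : ℝ) * v ^ (2 * k - 2)) ∧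
      ∀ v : ℝ, 0 ≤ deriv (deriv fun v : ℝ => v ^ (2 * k)) v := by
  have hd1 : deriv (fun v : ℝ => v ^ (2 * k)) = fun v => (2 * k : ℝ) * v ^ (2 * k - 1) := by
    funext v
    rw [deriv_pow_field]
    push_cast
    ring
  have hd2 : deriv (deriv fun v : ℝ => v ^ (2 * k)) =
      fun v => (2 * k : ℝ) * (2 * k - 1 : ℝ) * v ^ (2 * k - 2) := by
    rw [hd1]
    funext v
    rw [deriv_const_mul_field, deriv_pow_field]
    have : ((2 * k - 1 : ℕ) : ℝ) = 2 * k - 1 := by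
      rw [Nat.cast_sub (by omega)]
      push_cast
      ring
    rw [this, show 2 * k - 1 - 1 = 2 * k - 2 by omega]
    ring
  refine ⟨contDiff_id.pow _, zero_pow (by omega), ?_, hd2, fun v => ?_⟩
  · rw [hd1]
    show (2 * k : ℝ) * (0 : ℝ) ^ (2 * k - 1) = 0
    rw [zero_pow (by omega), mul_zero]
  · rw [hd2]
    show 0 ≤ (2 * k : ℝ) * (2 * k - 1 : ℝ) * v ^ (2 * k - 2)
    have h2 : 2 * k - 2 = 2 * (k - 1) := by omega
    rw [h2, pow_mul]
    have hk1 : (0 : ℝ) ≤ 2 * k - 1 := by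
      have : (1 : ℝ) ≤ k := by exact_mod_cast hk
      linarith
    exact mul_nonneg (mul_nonneg (by positivity) hk1) (pow_nonneg (sq_nonneg _) _)

/-- **The `L^{2k}` balance with dissipation for `ω_θ/r`** (Feng–Šverák, proof of Lemma 3.8, the
display for `−dE_p/dt` integrated in time, `p = 2k`). For a Tao-class solution on `[0, T]` with
`ν ≥ 0`, axisymmetric without swirl at all times, `k ≥ 1` and `0 ≤ s ≤ t ≤ T`, with
`η = angVortQuot = ω_θ/r`:

  `∫ η(t)^{2k} dx + ν (2k)(2k−1) ∫_{τ ∈ s..t} ∫ η(τ)^{2k−2} ‖∇η(τ)‖² dx dτ ≤ ∫ η(s)^{2k} dx.`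

[cite: FengSverak2015, proof of Lemma 3.8 (arXiv:1301.6317 p. 12, `−dE_p/dt = ∫p(p−1)η^{p−2}|∇η|² + 4π∫[η^p]_{r=0}dz`); GallaySverak2016, §5 Lemma 5.2 (arXiv p. 16)] -/
theorem IsTaoSolutionOn.integral_pow_angVortQuot_add_dissipation_le (h : IsTaoSolutionOn T ν u₀ v q)
    (hT : 0 < T) (hν : 0 ≤ ν) (hax : ∀ t ∈ Icc 0 T, IsAxisymmetric (v t))
    (hsw : ∀ t ∈ Icc 0 T, HasNoSwirl (v t)) {k : ℕ} (hk : 1 ≤ k)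
    {s t : ℝ} (hs : s ∈ Icc 0 T) (ht : t ∈ Icc 0 T) (hst : s ≤ t) :
    (∫ x, angVortQuot (v t) x ^ (2 * k)) +
      ν * ((2 * k : ℝ) * (2 * k - 1)) * ∫ τ in s..t, ∫ x, angVortQuot (v τ) x ^ (2 * k - 2) *
        ‖fderiv ℝ (angVortQuot (v τ)) x‖ ^ 2 ≤ ∫ x, angVortQuot (v s) x ^ (2 * k) := by
  obtain ⟨hβ, h00, h0, hd2, hnn⟩ := pow_even_data hk
  have key := h.integral_comp_angVortQuot_add_dissipation_le hT hν hax hsw hβ h00 h0 hnn hs ht hst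
  rw [hd2] at key
  beta_reduce at key
  have e : ∫ τ in s..t, ∫ x, (2 * k : ℝ) * (2 * k - 1) * angVortQuot (v τ) x ^ (2 * k - 2) *
      ‖fderiv ℝ (angVortQuot (v τ)) x‖ ^ 2 =
      (2 * k : ℝ) * (2 * k - 1) * ∫ τ in s..t, ∫ x, angVortQuot (v τ) x ^ (2 * k - 2) *
        ‖fderiv ℝ (angVortQuot (v τ)) x‖ ^ 2 := by
    rw [← intervalIntegral.integral_const_mul]
    refine intervalIntegral.integral_congr fun τ _ => ?_
    rw [← integral_const_mul]
    refine integral_congr_ae (Eventually.of_forall fun x => ?_)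
    ring
  rw [e] at key
  linarith

/-- **The `L²` balance with dissipation for `ω_θ/r`** (`k = 1`): for a Tao-class solution on
`[0, T]` with `ν ≥ 0`, axisymmetric without swirl at all times, and `0 ≤ s ≤ t ≤ T`:
`∫ η(t)² dx + 2ν ∫ₛᵗ ∫ ‖∇η(τ)‖² dx dτ ≤ ∫ η(s)² dx`, `η = ω_θ/r` — the dissipative sharpening of
the tree's Ladyzhenskaya estimate `∫ η(t)² ≤ ∫ η(0)²` (`IsTaoSolutionOn.integral_hadamardQuotFst_sq_le`).
[cite: FengSverak2015, proof of Lemma 3.8 (arXiv p. 12, p = 2); GallaySverak2016, §5 Lemma 5.2 (arXiv p. 16)] -/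
theorem IsTaoSolutionOn.integral_sq_angVortQuot_add_dissipation_le (h : IsTaoSolutionOn T ν u₀ v q)
    (hT : 0 < T) (hν : 0 ≤ ν) (hax : ∀ t ∈ Icc 0 T, IsAxisymmetric (v t))
    (hsw : ∀ t ∈ Icc 0 T, HasNoSwirl (v t))
    {s t : ℝ} (hs : s ∈ Icc 0 T) (ht : t ∈ Icc 0 T) (hst : s ≤ t) :
    (∫ x, angVortQuot (v t) x ^ 2) +
      2 * ν * ∫ τ in s..t, ∫ x, ‖fderiv ℝ (angVortQuot (v τ)) x‖ ^ 2 ≤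
        ∫ x, angVortQuot (v s) x ^ 2 := by
  have key := h.integral_pow_angVortQuot_add_dissipation_le hT hν hax hsw (le_refl 1) hs ht hst
  norm_num at key
  linarith

/-- `‖D(G^k)(x)‖² = k² G(x)^{2k−2} ‖DG(x)‖²` for a differentiable scalar `G` and `k ≥ 1`.
[folklore] -/
private theorem norm_fderiv_pow_sq {G : EuclideanSpace ℝ (Fin 3) → ℝ} (hG : Differentiable ℝ G) {k : ℕ}
    (hk : 1 ≤ k) (x : EuclideanSpace ℝ (Fin 3)) :
    ‖fderiv ℝ (fun y => G y ^ k) x‖ ^ 2 = (k : ℝ) ^ 2 * G x ^ (2 * k - 2) * ‖fderiv ℝ G x‖ ^ 2 := by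
  have h1 : fderiv ℝ (fun y => G y ^ k) x = ((k : ℝ) * G x ^ (k - 1)) • fderiv ℝ G x := by
    rw [((hG x).hasFDerivAt.pow k).fderiv, nsmul_eq_mul]
  rw [h1, norm_smul, mul_pow, Real.norm_eq_abs, sq_abs, mul_pow, ← pow_mul,
    show (k - 1) * 2 = 2 * k - 2 by omega]

/-- **Feng–Šverák's form of the `L^p` balance** (`p = 2k`): for a Tao-class solution on `[0, T]`
with `ν ≥ 0`, axisymmetric without swirl at all times, `k ≥ 1`, `0 ≤ s ≤ t ≤ T`:

  `∫ η(t)^{2k} dx + ν (2(2k−1)/k) ∫_{τ ∈ s..t} ∫ ‖∇(η(τ)^k)‖² dx dτ ≤ ∫ η(s)^{2k} dx`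

(`p(p−1) η^{p−2}|∇η|² = (4(p−1)/p) |∇(η^{p/2})|²`, the printed
`−dE_p/dt ≥ (4(p−1)/p) ∫ |∇(η^{p/2})|² dx`), the input of the Nash iteration.
[cite: FengSverak2015, proof of Lemma 3.8 (arXiv:1301.6317 p. 12, last line of the display for −dE_p/dt)] -/
theorem IsTaoSolutionOn.integral_pow_angVortQuot_add_norm_fderiv_pow_le (h : IsTaoSolutionOn T ν u₀ v q)
    (hT : 0 < T) (hν : 0 ≤ ν) (hax : ∀ t ∈ Icc 0 T, IsAxisymmetric (v t))
    (hsw : ∀ t ∈ Icc 0 T, HasNoSwirl (v t)) {k : ℕ} (hk : 1 ≤ k)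
    {s t : ℝ} (hs : s ∈ Icc 0 T) (ht : t ∈ Icc 0 T) (hst : s ≤ t) :
    (∫ x, angVortQuot (v t) x ^ (2 * k)) +
      ν * (2 * (2 * k - 1) / k : ℝ) * ∫ τ in s..t, ∫ x,
        ‖fderiv ℝ (fun y => angVortQuot (v τ) y ^ k) x‖ ^ 2 ≤ ∫ x, angVortQuot (v s) x ^ (2 * k) := by
  have hvs : ∀ τ ∈ Icc 0 T, ContDiff ℝ ∞ (v τ) := fun τ hτ => h.classical.contDiff_velocity hτ
  have hΩd : ∀ τ ∈ Icc 0 T, Differentiable ℝ (angVortQuot (v τ)) := fun τ hτ =>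
    (contDiff_angVortQuot (n := 1) (by exact_mod_cast (hvs τ hτ).of_le (by norm_cast))).differentiable
      one_ne_zero
  have key := h.integral_pow_angVortQuot_add_dissipation_le hT hν hax hsw hk hs ht hst
  have hk0 : (k : ℝ) ≠ 0 := by
    have : (0 : ℝ) < k := by exact_mod_cast hk
    exact this.ne'
  -- rewrite the inner integrals on `(s, t)`
  have e : ∫ τ in s..t, ∫ x, ‖fderiv ℝ (fun y => angVortQuot (v τ) y ^ k) x‖ ^ 2 =
      (k : ℝ) ^ 2 * ∫ τ in s..t, ∫ x, angVortQuot (v τ) x ^ (2 * k - 2) *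
        ‖fderiv ℝ (angVortQuot (v τ)) x‖ ^ 2 := by
    rw [← intervalIntegral.integral_const_mul]
    refine intervalIntegral.integral_congr fun τ hτ => ?_
    have hτI : τ ∈ Icc 0 T := by
      rw [uIcc_of_le hst] at hτ
      exact ⟨hs.1.trans hτ.1, hτ.2.trans ht.2⟩
    rw [← integral_const_mul]
    refine integral_congr_ae (Eventually.of_forall fun x => ?_)
    beta_reduce
    rw [norm_fderiv_pow_sq (hΩd τ hτI) hk x]
    ring
  rw [e]
  have e2 : ν * (2 * (2 * k - 1) / k : ℝ) * ((k : ℝ) ^ 2 * ∫ τ in s..t, ∫ x,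
      angVortQuot (v τ) x ^ (2 * k - 2) * ‖fderiv ℝ (angVortQuot (v τ)) x‖ ^ 2) =
      ν * ((2 * k : ℝ) * (2 * k - 1)) * ∫ τ in s..t, ∫ x, angVortQuot (v τ) x ^ (2 * k - 2) *
        ‖fderiv ℝ (angVortQuot (v τ)) x‖ ^ 2 := by
    have e3 : (2 * (2 * k - 1) / k : ℝ) * (k : ℝ) ^ 2 = (2 * k : ℝ) * (2 * k - 1) := by
      rw [div_mul_eq_mul_div, div_eq_iff hk0]
      ring
    rw [← e3]
    ring
  rw [e2]
  exact key

/-- **The `L^{2k}` balance from the datum** (`ν > 0`, axisymmetric swirl-free datum): for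
`k ≥ 1`, `0 ≤ s ≤ t ≤ T`,
`∫ η(t)^{2k} + ν(2k)(2k−1)∫ₛᵗ∫ η^{2k−2}‖∇η‖² ≤ ∫ η(s)^{2k}`.
[cite: FengSverak2015, proof of Lemma 3.8 (arXiv p. 12); GallaySverak2016, §5 Lemma 5.2 (arXiv p. 16)] -/
theorem IsTaoSolutionOn.integral_pow_angVortQuot_add_dissipation_le_of_datum
    (h : IsTaoSolutionOn T ν u₀ v q) (hT : 0 < T) (hν : 0 < ν) (h₀ : IsAxisymmetric u₀)
    (h₀' : HasNoSwirl u₀) {k : ℕ} (hk : 1 ≤ k)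
    {s t : ℝ} (hs : s ∈ Icc 0 T) (ht : t ∈ Icc 0 T) (hst : s ≤ t) :
    (∫ x, angVortQuot (v t) x ^ (2 * k)) +
      ν * ((2 * k : ℝ) * (2 * k - 1)) * ∫ τ in s..t, ∫ x, angVortQuot (v τ) x ^ (2 * k - 2) *
        ‖fderiv ℝ (angVortQuot (v τ)) x‖ ^ 2 ≤ ∫ x, angVortQuot (v s) x ^ (2 * k) :=
  h.integral_pow_angVortQuot_add_dissipation_le hT hν.le (h.isAxisymmetric hν hT h₀)
    (h.hasNoSwirl hν hT h₀ h₀') hk hs ht hst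

end Powers

/-! ### Continuity in time of `∫ β(ω_θ/r)` and integrability of the power dissipation
(the regularity used when the balance is fed to the Nash/ODE iteration) -/

section Continuity

variable {T ν : ℝ} {u₀ : EuclideanSpace ℝ (Fin 3) → EuclideanSpace ℝ (Fin 3)}
  {v : ℝ → EuclideanSpace ℝ (Fin 3) → EuclideanSpace ℝ (Fin 3)} {q : ℝ → EuclideanSpace ℝ (Fin 3) → ℝ}
  {β : ℝ → ℝ}

/-- **`t ↦ ∫ β(η(t, x)) dx` is continuous on `[0, T]`** along a Tao-class solution with
axisymmetric slices, for `β ∈ C²` with `β(0) = β'(0) = 0` (`η = angVortQuot = ω_θ/r`): it is the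
primitive `∫ β(η(b)) = ∫ β(η(0)) + ∫₀ᵇ ∫ β'(η) ∂ₜη dx dτ` of a time-integrable function (the tree's
`integral_comp_eq_add_of_ae_hasDerivAt`; `η` jointly smooth and bounded, `η, ∂ₜη` uniformly in `L²`).
This is the (absolute) continuity of Feng–Šverák's `E_p(t) = ∫ η^p dx`, which they differentiate in
`t`. [cite: FengSverak2015, proof of Lemma 3.8 (arXiv p. 12, `E_p(t)` and `dE_p/dt`)] -/
theorem IsTaoSolutionOn.continuousOn_integral_comp_angVortQuot (h : IsTaoSolutionOn T ν u₀ v q)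
    (hT : 0 < T) (hax : ∀ t ∈ Icc 0 T, IsAxisymmetric (v t))
    (hβ : ContDiff ℝ 2 β) (h00 : β 0 = 0) (h0 : deriv β 0 = 0) :
    ContinuousOn (fun t => ∫ x, β (angVortQuot (v t) x)) (Icc 0 T) := by
  have hU : UniqueDiffOn ℝ (Icc 0 T) := uniqueDiffOn_Icc hT
  have hcl := Icc_subset_closure_interior_Icc' hT
  obtain ⟨F, -, hF⟩ := h.exists_forall_abs_angVortQuot_le hax
  obtain ⟨K, hK0, hK⟩ := exists_abs_deriv_deriv_le hβ F
  obtain ⟨hd, hd'⟩ := differentiable_of_contDiff_two hβ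
  have hβ1 : ContDiff ℝ 1 β := hβ.of_le (by norm_num)
  have hsm : IsSmoothSpaceTimeOn (Icc 0 T) v := h.classical.smooth_velocity
  have hvs : ∀ t ∈ Icc 0 T, ContDiff ℝ ∞ (v t) := fun t ht => h.classical.contDiff_velocity ht
  have hΩc : ∀ t ∈ Icc 0 T, Continuous (angVortQuot (v t)) := fun t ht =>
    (contDiff_angVortQuot (n := 0) (by exact_mod_cast (hvs t ht).of_le (by norm_cast))).continuous
  have hΩ : IsSmoothSpaceTimeOn (Icc 0 T) (fun t => angVortQuot (v t)) :=
    hsm.angVortQuot_family (convex_Icc 0 T) hU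
  have hΩ' : IsSmoothSpaceTimeOn (Icc 0 T) (timeDerivWithin (Icc 0 T) fun t => angVortQuot (v t)) :=
    hΩ.timeDerivWithin hU
  have hdt : ∀ t ∈ Icc 0 T, ∀ x, timeDerivWithin (Icc 0 T) (fun s => angVortQuot (v s)) t x =
      angVortQuot (timeDerivWithin (Icc 0 T) v t) x := fun t ht x =>
    hsm.timeDerivWithin_angVortQuot (convex_Icc 0 T) hU hcl hax ht x
  have tl : ∀ {w : ℝ → EuclideanSpace ℝ (Fin 3) → ℝ},
      ContinuousOn (uncurry w) (Icc 0 T ×ˢ univ) → ∀ x, ContinuousOn (fun s => w s x) (Icc 0 T) := by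
    intro w hw x
    exact hw.comp (continuous_id.prodMk continuous_const).continuousOn
      fun s hs => mk_mem_prod hs (mem_univ x)
  obtain ⟨C, hC⟩ := h.exists_lintegral_sq_quot_le hT hax
  -- (i) time lines
  have hline : ∀ᵐ x ∂(volume : Measure (EuclideanSpace ℝ (Fin 3))),
      ContinuousOn (fun t => angVortQuot (v t) x) (Icc 0 T) ∧
      ContinuousOn (fun t => angVortQuot (timeDerivWithin (Icc 0 T) v t) x) (Icc 0 T) ∧
      ∀ t ∈ Ioo 0 T, HasDerivAt (fun t => angVortQuot (v t) x)
        (angVortQuot (timeDerivWithin (Icc 0 T) v t) x) t := by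
    refine ae_of_all _ fun x => ⟨tl hΩ.continuousOn x, (tl hΩ'.continuousOn x).congr fun s hs =>
      (hdt s hs x).symm, fun t ht => ?_⟩
    have htI : t ∈ Icc 0 T := Ioo_subset_Icc_self ht
    have h1 : HasDerivWithinAt (fun s => angVortQuot (v s) x)
        (timeDerivWithin (Icc 0 T) (fun s => angVortQuot (v s)) t x) (Icc 0 T) t := by
      rw [timeDerivWithin_apply]
      exact (hΩ.differentiableWithinAt_time htI x).hasDerivWithinAt
    rw [hdt t htI x] at h1
    exact h1.hasDerivAt (Icc_mem_nhds ht.1 ht.2)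
  -- (ii) joint measurability of `β'(η) η'`
  have hmeas : AEStronglyMeasurable (uncurry fun t x => deriv β (angVortQuot (v t) x) *
      angVortQuot (timeDerivWithin (Icc 0 T) v t) x) ((volume.restrict (Ioo 0 T)).prod volume) := by
    refine aestronglyMeasurable_prod_of_continuousOn_off_axis ?_
    have hsub : Ioo 0 T ×ˢ {x : EuclideanSpace ℝ (Fin 3) | cylRadius x ≠ 0} ⊆ Icc 0 T ×ˢ univ :=
      prod_mono Ioo_subset_Icc_self (subset_univ _)
    have c1 : ContinuousOn (fun p : ℝ × EuclideanSpace ℝ (Fin 3) => deriv β (uncurry (fun t x =>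
        angVortQuot (v t) x) p)) (Icc 0 T ×ˢ univ) := hd'.continuous.comp_continuousOn hΩ.continuousOn
    have c2 : ContinuousOn (uncurry (timeDerivWithin (Icc 0 T) fun t => angVortQuot (v t)))
        (Icc 0 T ×ˢ univ) := hΩ'.continuousOn
    refine ((c1.mul c2).mono hsub).congr fun p hp => ?_
    obtain ⟨t, x⟩ := p
    have htI : t ∈ Icc 0 T := Ioo_subset_Icc_self hp.1
    simp only [Pi.mul_apply, uncurry_apply_pair]
    rw [hdt t htI x]
  -- (iii) uniform `L¹` bound of `β'(η) η'`
  have hbound : ∀ t ∈ Ioo 0 T, ∫⁻ x, ‖deriv β (angVortQuot (v t) x) *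
      angVortQuot (timeDerivWithin (Icc 0 T) v t) x‖ₑ ≤ ENNReal.ofReal K * ((C : ℝ≥0∞) + C) := by
    intro t ht
    have htI : t ∈ Icc 0 T := Ioo_subset_Icc_self ht
    obtain ⟨hΩC, hΩ'C, -, -⟩ := hC t htI
    calc ∫⁻ x, ‖deriv β (angVortQuot (v t) x) * angVortQuot (timeDerivWithin (Icc 0 T) v t) x‖ₑ
        ≤ ∫⁻ x, ENNReal.ofReal K * (‖angVortQuot (v t) x‖ₑ ^ 2 +
            ‖angVortQuot (timeDerivWithin (Icc 0 T) v t) x‖ₑ ^ 2) := by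
          refine lintegral_mono fun x => ?_
          rw [enorm_mul]
          calc ‖deriv β (angVortQuot (v t) x)‖ₑ * ‖angVortQuot (timeDerivWithin (Icc 0 T) v t) x‖ₑ
              ≤ (ENNReal.ofReal K * ‖angVortQuot (v t) x‖ₑ) *
                  ‖angVortQuot (timeDerivWithin (Icc 0 T) v t) x‖ₑ := by
                gcongr
                have hb := abs_deriv_le_mul_abs hβ h0 hK (hF t htI x)
                rw [← Real.enorm_eq_ofReal hK0, ← enorm_mul, Real.enorm_eq_ofReal_abs,
                  Real.enorm_eq_ofReal_abs, abs_mul, abs_of_nonneg hK0]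
                exact ENNReal.ofReal_le_ofReal hb
            _ = ENNReal.ofReal K * (‖angVortQuot (v t) x‖ₑ *
                  ‖angVortQuot (timeDerivWithin (Icc 0 T) v t) x‖ₑ) := mul_assoc _ _ _
            _ ≤ ENNReal.ofReal K * (‖angVortQuot (v t) x‖ₑ ^ 2 +
                  ‖angVortQuot (timeDerivWithin (Icc 0 T) v t) x‖ₑ ^ 2) := by
                gcongr
                exact ennreal_mul_le_sq_add_sq _ _
      _ = ENNReal.ofReal K * ((∫⁻ x, ‖angVortQuot (v t) x‖ₑ ^ 2) +
            ∫⁻ x, ‖angVortQuot (timeDerivWithin (Icc 0 T) v t) x‖ₑ ^ 2) := by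
          have hmΩ : Measurable fun x => ‖angVortQuot (v t) x‖ₑ ^ 2 :=
            (hΩc t htI).measurable.enorm.pow_const 2
          rw [lintegral_const_mul' _ _ ENNReal.ofReal_ne_top, lintegral_add_left hmΩ]
      _ ≤ ENNReal.ofReal K * ((C : ℝ≥0∞) + C) := by gcongr
  -- (iv) slices `β(η(t))` are integrable
  have hint : ∀ t ∈ Icc 0 T, Integrable (fun x => β (angVortQuot (v t) x)) := by
    intro t ht
    obtain ⟨m0, -, -, -⟩ := h.memLp_angVortQuot_data hax ht
    exact integrable_comp_of_abs_le hβ h00 h0 hK (hF t ht) (hΩc t ht) m0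
  -- (v) the time function `Φ(τ) = ∫ β'(η) η'` is integrable on `(0, T)`
  have hKtop : ENNReal.ofReal K * ((C : ℝ≥0∞) + C) ≠ ⊤ :=
    ENNReal.mul_ne_top ENNReal.ofReal_ne_top (by simp)
  set Φ : ℝ → ℝ := fun τ => ∫ x, deriv β (angVortQuot (v τ) x) *
    angVortQuot (timeDerivWithin (Icc 0 T) v τ) x with hΦ
  have hΦint : IntegrableOn Φ (Ioo 0 T) := by
    have hI : Integrable (uncurry fun t x => deriv β (angVortQuot (v t) x) *
        angVortQuot (timeDerivWithin (Icc 0 T) v t) x) ((volume.restrict (Ioo 0 T)).prod volume) := by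
      refine ⟨hmeas, ?_⟩
      have hle := lintegral_prod_le (μ := volume.restrict (Ioo 0 T)) (ν := volume)
        (fun z : ℝ × EuclideanSpace ℝ (Fin 3) => ‖uncurry (fun t x => deriv β (angVortQuot (v t) x) *
          angVortQuot (timeDerivWithin (Icc 0 T) v t) x) z‖ₑ)
      refine lt_of_le_of_lt hle ?_
      calc ∫⁻ t in Ioo 0 T, ∫⁻ x, ‖uncurry (fun t x => deriv β (angVortQuot (v t) x) *
            angVortQuot (timeDerivWithin (Icc 0 T) v t) x) (t, x)‖ₑ
          ≤ ∫⁻ _ in Ioo 0 T, ENNReal.ofReal K * ((C : ℝ≥0∞) + C) :=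
            setLIntegral_mono' measurableSet_Ioo fun t ht => hbound t ht
        _ < ⊤ := by
            rw [setLIntegral_const]
            exact ENNReal.mul_lt_top hKtop.lt_top (by simp)
    have := hI.integral_prod_left
    simp only [uncurry_apply_pair] at this
    rw [IntegrableOn, hΦ]
    exact this
  -- (vi) `∫ β(η(b)) = ∫ β(η(0)) + ∫₀ᵇ Φ` on `[0, T]`
  have hId : ∀ b ∈ Icc 0 T, ∫ x, β (angVortQuot (v b) x) =
      (∫ x, β (angVortQuot (v 0) x)) + ∫ τ in (0 : ℝ)..b, Φ τ := by
    intro b hb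
    rcases hb.1.eq_or_lt with hb0 | hb0
    · rw [← hb0]
      simp
    · rw [integral_comp_eq_add_of_ae_hasDerivAt (μ := volume) (T := T) hβ1 hline hmeas hKtop hbound
        hint ⟨hb0, hb.2⟩, intervalIntegral.integral_of_le hb.1, integral_Ioc_eq_integral_Ioo]
  -- (vii) continuity of the primitive
  have hΦi : IntervalIntegrable Φ volume 0 T := by
    rw [intervalIntegrable_iff_integrableOn_Ioo_of_le hT.le]
    exact hΦint
  have hprim := intervalIntegral.continuousOn_primitive_interval' hΦi (left_mem_uIcc (a := (0 : ℝ))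
    (b := T))
  rw [uIcc_of_le hT.le] at hprim
  exact ((continuousOn_const.add hprim).congr fun b hb => hId b hb)

/-- **`E_p(t) = ∫ η(t)^{2k} dx` is continuous on `[0, T]`** (`k ≥ 1`) along a Tao-class solution with
axisymmetric slices. [cite: FengSverak2015, proof of Lemma 3.8 (arXiv p. 12, `E_p(t)`)] -/
theorem IsTaoSolutionOn.continuousOn_integral_pow_angVortQuot (h : IsTaoSolutionOn T ν u₀ v q)
    (hT : 0 < T) (hax : ∀ t ∈ Icc 0 T, IsAxisymmetric (v t)) {k : ℕ} (hk : 1 ≤ k) :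
    ContinuousOn (fun t => ∫ x, angVortQuot (v t) x ^ (2 * k)) (Icc 0 T) := by
  obtain ⟨hβ, h00, h0, -, -⟩ := pow_even_data hk
  exact h.continuousOn_integral_comp_angVortQuot hT hax hβ h00 h0

/-- **The power dissipation is time-integrable**: along a Tao-class solution with axisymmetric
slices and `k ≥ 1`, `τ ↦ ∫ η(τ)^{2k−2} ‖∇η(τ)‖² dx` is integrable on `(0, T)` (Feng–Šverák's
`∫ p(p−1) η^{p−2}|∇η|² dx`, integrated in time in the proof of Lemma 3.8).
[cite: FengSverak2015, proof of Lemma 3.8 (arXiv p. 12, time integration of the display for −dE_p/dt)] -/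
theorem IsTaoSolutionOn.integrableOn_integral_pow_mul_norm_fderiv_sq (h : IsTaoSolutionOn T ν u₀ v q)
    (hT : 0 < T) (hax : ∀ t ∈ Icc 0 T, IsAxisymmetric (v t)) {k : ℕ} (hk : 1 ≤ k) :
    IntegrableOn (fun τ => ∫ x, angVortQuot (v τ) x ^ (2 * k - 2) *
      ‖fderiv ℝ (angVortQuot (v τ)) x‖ ^ 2) (Ioo 0 T) := by
  obtain ⟨hβ, -, -, hd2, -⟩ := pow_even_data hk
  have key := h.integrableOn_integral_deriv_deriv_comp_mul_norm_fderiv_sq hT hax hβ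
  rw [hd2] at key
  beta_reduce at key
  have hc : (2 * k : ℝ) * (2 * k - 1) ≠ 0 := by
    have h1 : (1 : ℝ) ≤ k := by exact_mod_cast hk
    have h2 : (0 : ℝ) < 2 * k := by linarith
    have h3 : (0 : ℝ) < 2 * k - 1 := by linarith
    exact mul_ne_zero h2.ne' h3.ne'
  have e : ∀ τ, ∫ x, (2 * k : ℝ) * (2 * k - 1) * angVortQuot (v τ) x ^ (2 * k - 2) *
      ‖fderiv ℝ (angVortQuot (v τ)) x‖ ^ 2 =
      (2 * k : ℝ) * (2 * k - 1) * ∫ x, angVortQuot (v τ) x ^ (2 * k - 2) *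
        ‖fderiv ℝ (angVortQuot (v τ)) x‖ ^ 2 := by
    intro τ
    rw [← integral_const_mul]
    refine integral_congr_ae (Eventually.of_forall fun x => ?_)
    ring
  simp_rw [e] at key
  have key' : IntegrableOn (fun τ => ((2 * k : ℝ) * (2 * k - 1))⁻¹ * ((2 * k : ℝ) * (2 * k - 1) *
      ∫ x, angVortQuot (v τ) x ^ (2 * k - 2) * ‖fderiv ℝ (angVortQuot (v τ)) x‖ ^ 2)) (Ioo 0 T) :=
    key.const_mul ((2 * k : ℝ) * (2 * k - 1))⁻¹
  refine key'.congr_fun (fun τ _ => ?_) measurableSet_Ioo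
  beta_reduce
  rw [← mul_assoc, inv_mul_cancel₀ hc, one_mul]

/-- **Feng–Šverák's dissipation `∫ ‖∇(η^k)‖² dx` is time-integrable** on `(0, T)` (`k ≥ 1`) along a
Tao-class solution with axisymmetric slices (`‖∇(η^k)‖² = k² η^{2k−2}‖∇η‖²`).
[cite: FengSverak2015, proof of Lemma 3.8 (arXiv p. 12, `∫ |∇(η^{p/2})|² dx` integrated in time)] -/
theorem IsTaoSolutionOn.integrableOn_integral_norm_fderiv_pow_sq (h : IsTaoSolutionOn T ν u₀ v q)
    (hT : 0 < T) (hax : ∀ t ∈ Icc 0 T, IsAxisymmetric (v t)) {k : ℕ} (hk : 1 ≤ k) :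
    IntegrableOn (fun τ => ∫ x, ‖fderiv ℝ (fun y => angVortQuot (v τ) y ^ k) x‖ ^ 2) (Ioo 0 T) := by
  have hvs : ∀ τ ∈ Icc 0 T, ContDiff ℝ ∞ (v τ) := fun τ hτ => h.classical.contDiff_velocity hτ
  have hΩd : ∀ τ ∈ Icc 0 T, Differentiable ℝ (angVortQuot (v τ)) := fun τ hτ =>
    (contDiff_angVortQuot (n := 1) (by exact_mod_cast (hvs τ hτ).of_le (by norm_cast))).differentiable
      one_ne_zero
  have key : IntegrableOn (fun τ => (k : ℝ) ^ 2 * ∫ x, angVortQuot (v τ) x ^ (2 * k - 2) *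
      ‖fderiv ℝ (angVortQuot (v τ)) x‖ ^ 2) (Ioo 0 T) :=
    (h.integrableOn_integral_pow_mul_norm_fderiv_sq hT hax hk).const_mul ((k : ℝ) ^ 2)
  refine key.congr_fun (fun τ hτ => ?_) measurableSet_Ioo
  have hτI : τ ∈ Icc 0 T := Ioo_subset_Icc_self hτ
  beta_reduce
  rw [← integral_const_mul]
  refine integral_congr_ae (Eventually.of_forall fun x => ?_)
  beta_reduce
  rw [norm_fderiv_pow_sq (hΩd τ hτI) hk x]
  ring

end Continuity

end Literature.Analysis.FluidPDE
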